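import Literature.MathematicalPhysics.QuantumFieldTheory.Balaban1983to89.B8Thm2TorusAt
import Literature.MathematicalPhysics.QuantumFieldTheory.Balaban1983to89.B8Thm2GaugeFixedKLevel
import Literature.MathematicalPhysics.QuantumFieldTheory.Balaban1983to89.B8Thm4UniqueLocal
import Literature.MathematicalPhysics.QuantumFieldTheory.Balaban1983to89.B8Ineq166Univ

/-!
# `Balaban1983to89.B8Thm2TorusSupplier` — T. Bałaban, *Spaces of regular gauge field configurations on a lattice and gauge fixing
# conditions*, Commun. Math. Phys. **99** (1985) 75–102 [Balaban1985RegularSpaces] ("B8"), **THEOREM 2** (p. 83) FOR THE DOMAIN SEQUENCE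
# `Ω_j = T_η` (p. 77, admitted case), AS PRINTED AND WITH UNIQUENESS, SUPPLIED MODULO SOCKETS: the interface
# `B8Thm2TorusAt.Thm2TorusAt L k P η β₀ B₁ B₂ c₁ len G (fun _ => True)` (consumers: `B8Thm2SetupTorus.thm2SetupSUAt_of_thm2TorusAt` → the
# T³ lane's `Thm2SetupSUAt … (fun _ => True)` → `Summits/…/UnitScaleTiltProp7SPrintThm2Dict`, item stmt-QuantumFields-19200 row P-V3-A) is a
# THEOREM once Proposition 5 (existence at every level of Theorem 4's induction, uniqueness (1.109) at level `k`), the in-edge (1.59)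
# (= Theorem 3.3 of [4]) and the (1.42) clause are given — print's own architecture, pp. 87–88 «Thus the conditions (1.33)–(1.35) imply
# (1.66) … Theorem 4 … Of course this theorem implies Theorem 2. Proposition 3 implies that it is enough to prove (1.37), (1.38) and (1.67)»,
# p. 95 «Thus all the assumptions of Proposition 3 are satisfied … To prove the uniqueness …»

statement-level skeleton of published theorems with citation tags; proofs where landed; nothing here is a claim about the Yang–Mills mass gap

PDF held: `paper:balaban1985-cmp99-regular-spaces-gauge-fixing` (journal page = PDF page + 74); pp. 82–83, 86–89, 94–95 [PDF 8–9, 12–15,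
20–21] read on the text layer by this seat (`lit read`, 2026-08-28); [3] = [Balaban1985Averaging], [4] = [Balaban1985BackgroundPropagators].
STATUS: published, refereed.

CITATION HEADER (lean-in-tree rule).  Cell `lit-balaban` (HOME `run/shared/lean/pub/lit-balaban/`), seat `lit-balaban-t2s-1` — sub-row
«B8 §3 Thm 2 TORUS SUPPLIER» booked by director-ym №36 (2026-08-27T23:49Z) for R3 item stmt-QuantumFields-19200 (`--supports`, helper):
«port AS PRINTED Theorem 2 on the torus to supply `B8Thm2TorusAt.Thm2TorusAt … specialUnitaryUnits (fun _ => True)` (consumers exist, NO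
supplier in tree; ℤᵈ existence half = `B8Thm2GaugeFixedKLevel.thm2_exists_gaugeFixed_kLevel` modulo sockets — mirror its socket discipline:
numeric windows + Prop 5/Thm 4 induction sockets + abstract Landau letters as explicit hypotheses, 0 facts, 0 sorry)».  WHAT IS REPRODUCED =
the three printed sentences by which Theorem 2 follows from the rest of the paper: (a) p. 87 (1.65)–(1.66) «(1.33)–(1.35) imply |Ũ′ʲ − 1| <
11d²α₀ + α₁ … let us write α₁ instead of the right-hand side»; (b) p. 88 «Theorem 4 … Of course this theorem implies Theorem 2. Proposition
3 implies …» with Theorem 4's induction pp. 88–89, 94–95; (c) p. 95 the uniqueness paragraph.  ENGINES BY NAME (the `ℤᵈ` carriers of DAG node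
N05): `B8Ineq165Local.ineq165_local_pert` (lit-balaban p26), `B8Ineq166Univ.{flm_succ_coord, under_or_of_box_pair, pdevOn_box_lt_of_inAk}`,
`B8Thm4ExistsLocal.bond_1110_local`, `B8Thm4TruncationLocal.{base_datum, restr129_one}`, `B8Prop3GaugeFixedKLevel.{hP3_gaugeFixed_of_b9,
mem_unitaryUnits_of_mgauge_eq, eq_mgauge_inv_of_mgauge_eq, log_cfgExp_eq}`, `B8Thm2GaugeFixedKLevel.thm2_norms_gaugeFixed_kLevel`,
`B8Thm4UniqueLocal.lam_in_domain_local`, `B8Ineq1109Local.{ineq1109_scaled, mgauge_quotient_eq}`, `B8Prop6OfThm4.pdevOn_lt_of_inAk_top`,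
`B8ScaledSupNorm.{msup_le, msup_nonneg, scale_pos, weight_neg_natCast}`, `B8Eq155JBound.wsup_nonneg`.

## THE PRINTED TEXT (verbatim)

p. 83 [PDF 9]: «Theorem 2. There exist constants B₁, B₂(β₀), c₁ such that for arbitrary U₀, U′U₀ satisfying (1.33)–(1.35) with α₀ + α₁ ≦ c₁
there exists exactly one gauge transformation u satisfying (1.29) and such that the conditions (1.36)–(1.39) hold for the configuration
U₁ = U′^{u⁻¹}.»  (the displays (1.33)–(1.39), (1.29) are quoted in full in the module docstring of `B8Thm2TorusAt`.)  p. 87 [PDF 13]: «We will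
prove Theorem 2 by induction. To use the inductive assumptions easily we have to reformulate the conditions (1.35). … Thus the conditions
(1.33)–(1.35) imply |Ũ′ʲ − 1| < 11d²α₀ + α₁ on Ω_j^{(j)}. (1.65) We will assume that the above bounds hold instead of (1.35). For simplicity let
us write α₁ instead of the right-hand side above, so we assume that |(U′U₀)ʲ‾ − Ū₀ʲ| = |Ũ′ʲ − 1| < α₁ on Ω_j^{(j)}, j = 0, 1, …, k. (1.66)»
p. 88 [PDF 14]: «Theorem 4. There exists a constant c₁ such that for arbitrary U₀, U′U₀ satisfying (1.33), (1.34), (1.66) with α₀ + α₁ ≦ c₁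
there exists exactly one gauge transformation u satisfying (1.29) and such that the conditions (1.37), (1.38), (1.62) hold for the
configuration U₁ = U′^{u⁻¹}.  Of course this theorem implies Theorem 2. Proposition 3 implies that it is enough to prove (1.37), (1.38) and
U₁ = e^{iηA}, |A| < B′₁(α₀ + α₁)(Lʲη)⁻¹ on Ω_j, B′₁ = C′₁B₁ (1.67) … A proof of the first step, for k = 1, will be included in a proof of the
general step. Thus let us assume that Theorem 4 holds for some k − 1 and we will prove it for k.»  p. 89 [PDF 15]: «They are satisfied in the
case k = 1 also, if we take u₁ = 1, U′ = U₁ … at least for B₁ not too small».  p. 87 [PDF 13]: «Proposition 3. If U₀, U₁U₀ satisfy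
(1.40)–(1.42) … then U₁ satisfies (1.36)–(1.39) with B₁ = 5dLB₀, B₂(β₀) = 5dLB₀(β₀), where B₀, B₀(β₀) are the corresponding norms of the
operators G(U₀), H(U₀)».  p. 86 [PDF 12]: «Theorem 3.3 of [4] implies the bounds |A|₍₋₁₎, |∇^η_{U₀}A|₍₋₂₎, |Δ^η_{U₀}A|₍₋₃₎, ‖A‖_{1,β,(−2−β)} ≦
B₀(|J|₍₋₃₎ + |B₁|). (1.59)»  p. 94 [PDF 20]: «Proposition 5. … there exists a configuration u′ = e^{iλ} satisfying the equations … (1.107) … |λ|,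
|Dλ|₍₋₁₎ < 8B′₀B₁(α₀ + α₁). (1.108) Such a configuration u′ is unique in the domain |λ|, |Dλ|₍₋₁₎ < c₃. (1.109)»  p. 95 [PDF 21]: «It gives us a
gauge transformation u = u′u₁ such that the conditions (1.29), (1.37), (1.38) are satisfied … (1.110) … (1.111) … Thus all the assumptions of
Proposition 3 are satisfied and for α₀ + α₁ sufficiently small it implies Theorem 4, except the uniqueness statement.  To prove the uniqueness
let us assume that there are two transformations u₁, u₂ satisfying the conditions of the Theorem 4. … thus u′ is a solution of the problem
described in Proposition 5. … a configuration identically equal to 1 is a solution also … The uniqueness implies u′ = 1, or u₁ = u₂.»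

## WHAT THIS FILE PROVES (kernel; axioms `propext` ∕ `Classical.choice` ∕ `Quot.sound`; 0 sorry; no new fact — the `def`s are hypothesis
SHAPES with bodies (the sockets, asserted for nothing), real-valued constants, and the windows record)

* §1 bookkeeping of the all-torus geometry: every bond is a side of a plaquette touching `T_η` (`sideTouches_univ`, `d ≥ 2`); the constraint
  bonds of `torusLam m` live at level `m`; the level-`k` towers cover `ℤᵈ` (`inBox_tower_flm`); periodicity of the moving-frame action.
* §2 **`norm_sub_one_le_torus`** — (a): (1.33)–(1.35) ⇒ (1.66)₀ `‖U′_b − 1‖ ≤ 11d²α₀ + α₁` at every bond (the all-torus run of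
  `B8Ineq166Univ.norm_pert_sub_one_le_univ` with (1.35) consumed at level `k` only, as printed).
* §3 THE SOCKETS (hypothesis shapes on the torus carriers, per pair `U₀, U′`, `G`-valued `P`-periodic gauges): `SockP5Base` ∕ `SockP5Step`
  (Proposition 5, existence (1.107)–(1.108), at the first step and at the step `m ↦ m + 1`), `Sock142` (the (1.42) clause), `Sock159` (the
  in-edge (1.59), five pointwise lines `Lines159` at the top weight, right side `rhs159`), `SockP5Uniq` (Proposition 5, uniqueness (1.109), for
  level-`k` solution data); the Landau letter `LanT` ((1.38) in the multiplier form of record `B8Eq138LandauZd.IsLandau138W` + the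
  induction's own datum); §4 adapters to the `ℤᵈ` engines' currency (`h42_engine`, `h59_engine`).
* §5 **`torus_all_levels`** — (b), Theorem 4's induction on the torus with `u` `G`-valued and `P`-periodic (base `u = 1`; step `u ↦ uv`,
  (1.110) at every bond; Proposition 3's reset `2Lc⋆ + 8α₄ ↦ c⋆` by `hP3_gaugeFixed_of_b9`).
* §6 **`final_norms`** — Proposition 3 for the final field, the gradient ∕ (1.39) ∕ Hölder members pointwise (`thm2_norms_gaugeFixed_kLevel`
  through its abstract `Lp` ∕ `Hol` slots, once per pointwise quantity).
* §7 **`torus_unique`** — (c), the uniqueness clause from `SockP5Uniq` (λ′ in the domain (1.109) at every site AND every bond).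
* §8 **`thm2_torus_pair`**, **`thm2TorusAt_of_sockets`** : `Thm2TorusAt L k P η β₀ B₁ B₂ c₁ len G (fun _ => True)` for `G ≤ U(𝔸)`, from the
  windows `Thm2TorusWindows` and the sockets `Thm2TorusSockets` for every `α₀ + α₁ ≤ c₁`; **`thm2TorusAt_specialUnitary_of_sockets`** (`G =
  SU(N) ⊂ M_N(ℂ)`, operator norm).
* §9 **`thm2TorusWindows_threshold`** — non-vacuity of the windows: ONE `c₁ > 0` (depending on `d`, `L`, `B₀`, `B₄`, `B₁`, `c_u` only, not on
  `k`, `η`, `P`) below which all windows hold («for α₀ + α₁ sufficiently small», given `5dLB₀ ≥ 2` = «B₁ not too small»).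
* §10 **`thm2TorusAt_of_sockets_threshold`** (`∃ c₁ > 0, Thm2TorusAt …`) and **`thm2TorusUniform_of_sockets`** — PRINT'S QUANTIFIER ORDER
  `B8Thm2TorusAt.Thm2TorusUniform L β₀ len G (fun _ _ _ _ => True)`: one triple `(B₁, B₂(β₀), c₁)` for every `k ≥ 1`, `P`, `η > 0`, given the
  sockets for all of them.

## READINGS ∕ HONEST SCOPE

(i) A theorem MODULO SOCKETS, exactly as the `ℤᵈ` twin: Proposition 5 (Sects. C–E; both halves), the in-edge (1.59) (Theorem 3.3 of [4]) and
the (1.42) clause are NOT proved here or anywhere in the tree at a curved background — they are the explicit hypotheses `Thm2TorusSockets`;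
nothing of DAG node N05 is discharged; Theorem 2 itself is therefore NOT claimed outright.  (ii) Constants: Theorem 4 is run at print's renamed
`α₁ᵉ = 11d²α₀ + α₁` (p. 87), so Proposition 3 delivers `5dLB₀(α₀ + α₁ᵉ) ≤ 5dLB₀(1 + 11d²)(α₀ + α₁)`; the interface is supplied for every
`B₁ > 5dLB₀(1 + 11d²)`, `B₂ > 5dLB₀(β₀)(1 + 11d²)` (strict `<` as printed); the (1.37) member carries the `α₁` of (1.35) (top level), the
intermediate (1.42) clauses the renamed one.  (iii) Windows (`Thm2TorusWindows`) explicit and merely sufficient = those of the engines run by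
name («for α₀ + α₁ sufficiently small»; `2(11d²α₀ + α₁) ≤ c⋆` is p. 89 «at least for B₁ not too small»); a threshold `c₁ > 0` below which
they all hold is supplied (§9), independent of `k`, `η`, `P`.
(iv) Readings of record of `B8Thm2TorusAt` ∕ `B8LeafModelZd3`: `T_η` as `P`-periodic data on `ℤᵈ`, Ω_j = univ, Λ_j = `torusLam`, (1.29) =
`Restr129`, (1.38) multiplier form with `A = (1/iη) log U′^{u⁻¹}` (`logCfg`), (1.39)₂ componentwise, Hölder member over `AdmPair η len`;
`G ≤ unitaryUnits 𝔸`, `𝔸` a nontrivial C⋆-algebra (`M_N(ℂ)` for `SU(N)`), `d ≥ 2`, `L ≥ 2`, `k ≥ 1`.  (v) The located bond sets of the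
engines (`SideTouches`) are the whole lattice here, so no boundary-layer hazard (`B8LeafModelZd3Boundary`) arises.  Count-neutral helper toward
stmt-QuantumFields-19200 (`--supports`); nothing continuum ∕ ℝ⁴ ∕ OS ∕ mass-gap ∕ Clay.
-/

noncomputable section

open NormedSpace

namespace Literature.MathematicalPhysics.QuantumFieldTheory.Balaban1983to89.B8Thm2TorusSupplier

open Complex (I I_ne_zero)
open MatrixLog B7Prop1Explicit B7Prop2Explicit B7Prop1Local B7Eq92Concrete
open B8Lemma1NonAbelian (mulCfg pert e_nonneg)
open B8Ineq130 (tlo thi tlo_apply thi_apply)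
open B8Ineq132 (covDerivFwd InAk Under)
open B8Eq140Level (SideTouches isSide₁)
open B8Eq119TwistedAxial (InAx Restr129 inAx_iff)
open B8Eq184Proof (gaugeExp cfgExp)
open B8Eq146AExpansion (iEta plaqCovDeriv)
open B8Eq143PlaqExpansion (pdiv)
open B7Prop4GeneralLevels (logCovIter linCovIter)
open B8Eq155JBound (Jcur wsup)
open B8ScaledSupNorm (bondNorm msup weight)
open B8Eq138LandauZd (IsLandau138 IsLandau138W covLap logCfg)
open B9Eq340HolderZd (hquot AdmPair)
open B8Eq133Hypotheses (Hyp135)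
open B8Eq113ClassBk (bondsOn mem_bondsOn)
open B8Eq131Cubes (flm under_flm)
open B8Eq106Local (under_iff_tower)
open B12Ineq417Flat (shiftCfg)
open B7Prop3Flat (c3)
open B8Thm4TorusAt (torusLam mem_torusLam_iff torusLam_self torusLam_of_ne)
open B8Thm2TorusAt (Cond135T hyp135_torusLam_iff C136T C137T C139T Concl2T Thm2TorusAt)

-- `Site` alone could resolve to the torus sites of `Setup.lean`; re-export the `ℤ^d` sites of `B7Prop1Explicit`.
export B7Prop1Explicit (Site)

variable {d : ℕ}

/-! ## §1 Bookkeeping for the all-torus geometry `Ω_j = T_η`, `Λ_j = torusLam` -/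

section Bookkeeping

/-- For `d ≥ 2` EVERY bond of `ℤᵈ` is a side of a plaquette touching `T_η` (p. 77 bond/plaquette convention): the located set
`SideTouches T_η` of the `ℤᵈ` engines is the whole lattice.  (The summit-side twin `…BalabanUVNodes.N16.Thm4ZdOfLeaf.sideTouches_univ` is
not importable from `Literature/`; restated here in three lines.) [cite: Balaban1985RegularSpaces, p.77 (convention before (1.5))] -/
theorem sideTouches_univ (hd2 : 2 ≤ d) (y : Site d) (τ : Fin d) : SideTouches (Set.univ : Set (Site d)) y τ := by
  have h0 : 0 < d := by omega
  have h1 : 1 < d := by omega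
  by_cases hτ : τ = ⟨0, h0⟩
  · refine ⟨y, τ, ⟨1, h1⟩, ?_, Or.inl (Set.mem_univ _), isSide₁ _ _ _⟩
    rw [hτ]
    intro h
    have := congrArg Fin.val h
    simp at this
  · exact ⟨y, τ, ⟨0, h0⟩, hτ, Or.inl (Set.mem_univ _), isSide₁ _ _ _⟩

/-- The constraint bonds of `torusLam m` live at level `m` only. [cite: Balaban1985RegularSpaces, (1.5) p.77, p.77 (bond convention)] -/
theorem eq_of_mem_bondsOn_torusLam {m j : ℕ} {c : Site d × Fin d} (hc : c ∈ bondsOn (torusLam (d := d) m) j) : j = m := by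
  by_contra hjm
  rw [mem_bondsOn, torusLam_of_ne hjm] at hc
  rcases hc with hc | hc <;> exact hc

/-- … and every level-`m` bond is one. [cite: Balaban1985RegularSpaces, (1.5) p.77, p.77 (bond convention)] -/
theorem mem_bondsOn_torusLam_self (m : ℕ) (c : Site d × Fin d) : c ∈ bondsOn (torusLam (d := d) m) m :=
  (mem_bondsOn _ _ _ _).2 (Or.inl (by rw [torusLam_self]; exact Set.mem_univ _))

/-- Every site lies in the level-`k` tower of its level-`k` block (the `L^k`-blocks tile `ℤᵈ`, p. 77 (1.4)).
[cite: Balaban1985RegularSpaces, (1.4) p.77] -/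
theorem inBox_tower_flm {L : ℕ} (hL : 1 ≤ L) (k : ℕ) (x : Site d) : InBox (tlo L (flm L k x) k) (thi L (flm L k x) k) x := by
  obtain ⟨h1, h2⟩ := (under_iff_tower L k (flm L k x) x).1 (under_flm hL k x)
  exact fun i => ⟨h1 i, h2 i⟩

variable {G : Type*} [Group G]

/-- The moving-frame action (1.17) of periodic data is periodic. [cite: Balaban1985RegularSpaces, (1.17) p.78, (1.3) p.77] -/
theorem mgauge_periodic {p : Site d} {V₀ U : Site d → Fin d → G} {v : Site d → G}
    (hV₀ : ∀ x κ, V₀ (x + p) κ = V₀ x κ) (hU : ∀ x κ, U (x + p) κ = U x κ) (hv : ∀ x, v (x + p) = v x)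
    (x : Site d) (κ : Fin d) : mgauge V₀ v U (x + p) κ = mgauge V₀ v U x κ := by
  simp only [mgauge_apply, hV₀, hU, hv, add_right_comm x p (e κ)]

omit [Group G] in
/-- Reading the periodicity binder `shiftCfg (P • e_i) U = U` bondwise. [cite: Balaban1985RegularSpaces, (1.3) p.77] -/
theorem apply_add_of_shiftCfg {P : ℤ} {U : Site d → Fin d → G} (hU : ∀ i : Fin d, shiftCfg (P • e i) U = U)
    (x : Site d) (i : Fin d) (κ : Fin d) : U (x + P • e i) κ = U x κ := by
  have := congrFun (congrFun (hU i) x) κ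
  simpa [shiftCfg] using this

end Bookkeeping

/-! ## §2 (1.33)–(1.35) ⟹ (1.66)₀ on the torus (p. 87 (1.65): «Thus the conditions (1.33)–(1.35) imply |Ũ′ʲ − 1| < 11d²α₀ + α₁») -/

section Ineq166

variable {𝔸 : Type*} [CStarAlgebra 𝔸] [Nontrivial 𝔸]

/-- **(1.66)₀ ON EVERY BOND OF THE TORUS FROM (1.33)–(1.35)** — the step by which «Theorem 4 implies Theorem 2» (p. 88): for
unitary-valued `U₀`, `U′` with (1.33) `U₀ ∈ 𝔄_k({T_η}, α₀)`, (1.34) `U′U₀ ∈ 𝔄_k({T_η}, α₀) ∩ Ax_k(𝔅_k, U₀)` (`𝔅_k` from `torusLam k`)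
and (1.35) `|(U′U₀)‾ᵏ − Ū₀ᵏ| < α₁` at every level-`k` bond (`Hyp135 L k (torusLam k)`), and the windows of (1.65): `‖U′_b − 1‖ ≤
11d²α₀ + α₁` at EVERY bond.  The all-torus instance of `B8Ineq166Univ.norm_pert_sub_one_le_univ` (towers = ALL level-`k` towers, which
cover `ℤᵈ`; (1.35) consumed at level `k` only, as printed): lit-balaban's `B8Ineq165Local.ineq165_local_pert` on the box of the two
level-`k` blocks of the end-points. [cite: Balaban1985RegularSpaces, (1.65)–(1.66) p.87, (1.33)–(1.35) p.82, (1.19) p.79, p.77 («Ω_j = T_η»)] -/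
theorem norm_sub_one_le_torus (hd : 1 ≤ d) {L : ℕ} (hL : 2 ≤ L) (k : ℕ) {η : ℝ}
    {U₀ U' : Site d → Fin d → 𝔸ˣ} (hU₀ : ∀ x κ, U₀ x κ ∈ unitaryUnits 𝔸) (hU' : ∀ x κ, U' x κ ∈ unitaryUnits 𝔸)
    {α₀ α₁ : ℝ} (hα₀ : 0 < α₀) (hα3 : C0 d * α₀ ≤ 1 / 3) (hα2 : 2 * α₀ ≤ c2' d L) (hα₁ : 0 ≤ α₁)
    (hsmall : 11 * (d : ℝ) ^ 2 * α₀ + α₁ ≤ 1 / 6)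
    (h33 : InAk L k η α₀ (fun _ => (Set.univ : Set (Site d))) U₀)
    (h34 : InAk L k η α₀ (fun _ => (Set.univ : Set (Site d))) (U' * U₀))
    (hAx : InAx L k (torusLam k) U₀ (U' * U₀)) (h35 : Hyp135 L k (torusLam k) α₁ U₀ U')
    (x : Site d) (μ : Fin d) : ‖((U' x μ : 𝔸ˣ) : 𝔸) - 1‖ ≤ 11 * (d : ℝ) ^ 2 * α₀ + α₁ := by
  have hL1 : 1 ≤ L := le_trans (by norm_num) hL
  have hG : AvgClosed d L (unitaryUnits 𝔸) := avgClosed_unitaryUnits d L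
  set U : Site d → Fin d → 𝔸ˣ := U' * U₀ with hU_def
  have hU : ∀ x κ, U x κ ∈ unitaryUnits 𝔸 := fun x κ => (unitaryUnits 𝔸).mul_mem (hU' x κ) (hU₀ x κ)
  have h35' : Cond135T L k U₀ U' α₁ := (hyp135_torusLam_iff L k U₀ U' α₁).1 h35
  -- the level-`k` blocks of the two end-points: equal or adjacent
  set z : Site d := flm L k x with hz_def
  set z' : Site d := flm L k (x + e μ) with hz'_def
  have hzx : Under L k z x := under_flm hL1 k x
  have hzx' : Under L k z' (x + e μ) := under_flm hL1 k (x + e μ)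
  have hzz' : z' = z ∨ z' = z + e μ := B8Ineq166Univ.flm_succ_coord hL1 k x μ
  have hlohi : z ≤ z' := by
    rcases hzz' with h | h
    · rw [h]
    · rw [h]; exact le_add_of_nonneg_right (e_nonneg μ)
  -- (1.7) inputs on the box of the two blocks
  have h33' : pdevOn (tlo L z k) (thi L z' k) U₀ < α₀ * (((L : ℝ) ^ k)⁻¹) ^ 2 :=
    B8Ineq166Univ.pdevOn_box_lt_of_inAk hL1 hα₀ h33 le_rfl fun _ _ => Set.mem_univ _
  have h34' : pdevOn (tlo L z k) (thi L z' k) U < α₀ * (((L : ℝ) ^ k)⁻¹) ^ 2 :=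
    B8Ineq166Univ.pdevOn_box_lt_of_inAk hL1 hα₀ h34 le_rfl fun _ _ => Set.mem_univ _
  -- (1.19) inputs on the box, from `Ax_k(𝔅_k, U₀)` along the towers of `z` and `z'` (both level-`k` constraint sites)
  have hAx' := (inAx_iff L k (torusLam k) U₀ U).1 hAx
  have hzk : z ∈ torusLam (d := d) k k := by rw [torusLam_self]; exact Set.mem_univ _
  have hz'k : z' ∈ torusLam (d := d) k k := by rw [torusLam_self]; exact Set.mem_univ _
  have h19 : ∀ n, n < k → ∀ w, tlo L z n ≤ w → w ≤ thi L z' n → ∀ r : Fin d → Fin L,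
      axialFn (avgIter L U (k - (n + 1))) ((L : ℤ) • w) ((L : ℤ) • w + boxVec L r) =
        axialFn (avgIter L U₀ (k - (n + 1))) ((L : ℤ) • w) ((L : ℤ) • w + boxVec L r) := by
    intro n hn w hlo hhi r
    have hk1 : 1 ≤ k := by omega
    have hdepth : k - (k - (n + 1) + 1) = n := by omega
    rcases B8Ineq166Univ.under_or_of_box_pair n hzz' hlo hhi with hw | hw
    · exact hAx' k hk1 le_rfl z hzk (k - (n + 1)) (by omega) w (by rw [hdepth]; exact hw) r
    · exact hAx' k hk1 le_rfl z' hz'k (k - (n + 1)) (by omega) w (by rw [hdepth]; exact hw) r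
  -- (1.35) input: the one crossing bond of the box (if any), a level-`k` bond
  have h35b : ∀ (w : Site d) (ν : Fin d), z ≤ w → w + e ν ≤ z' →
      ‖((avgIter L U k w ν : 𝔸ˣ) : 𝔸) - avgIter L U₀ k w ν‖ ≤ α₁ := fun w ν _ _ => (h35' w ν).le
  -- (1.65) on the box (lit-balaban p26), perturbation member, at the finest level
  have hV₀ : avgIter L U₀ (k - k) x μ ∈ U1 𝔸 := by
    rw [Nat.sub_self, avgIter_zero]; exact unitaryUnits_le_U1 (hU₀ x μ)
  have hxlo : tlo L z k ≤ x := ((under_iff_tower L k z x).1 hzx).1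
  have hxhi : x + e μ ≤ thi L z' k := ((under_iff_tower L k z' (x + e μ)).1 hzx').2
  have h := B8Ineq165Local.ineq165_local_pert L hL hd hG k U₀ U hU₀ hU hα₀ hα3 hα2 z z' hlohi h33' h34' h19 h35b hα₁ hsmall
    k le_rfl x μ hV₀ hxlo hxhi
  rw [Nat.sub_self, avgIter_zero, avgIter_zero] at h
  have hpert : pert U U₀ x μ = U' x μ := by
    simp [pert, hU_def]
  rw [hpert] at h
  exact h.le

end Ineq166

/-! ## §3 The sockets: the printed ingredients that Theorem 2's proof takes from Sects. C–E and from [4], as hypothesis SHAPES on the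
torus carriers (per pair `U₀, U′`; `G`-valued `P`-periodic gauge data; asserted for nothing) -/

section Sockets

variable {𝔸 : Type*} [NormedRing 𝔸] [StarRing 𝔸] [NormedAlgebra ℂ 𝔸] [CompleteSpace 𝔸]

/-- **The right side of (1.59) on the torus**, «B₀(|J|₍₋₃₎ + |B₁|)» without the factor `B₀` (p. 86): `|J|₍₋₃₎` of the current
`J = D^{η*}_{U₀}D^η_{U₀}A` of (1.55) (`B8Eq155JBound.Jcur`, weighted supremum `B8ScaledSupNorm.bondNorm` over the all-torus sequence) plus
`|B₁|`, `B₁ = LʲηQ_jA` on the constraint bonds ((1.56); the linearisation `B7Prop4GeneralLevels.linCovIter` on the bonds of `torusLam m`,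
all at level `m`) — verbatim the currency of the `ℤᵈ` engine `B8Prop3KLevel.prop3_norms_kLevel` at `Ω_j = T_η`, `Λb = bondsOn (torusLam m)`.
[cite: Balaban1985RegularSpaces, (1.55)–(1.56) p.86, (1.59) p.86] -/
def rhs159 (L m : ℕ) (η : ℝ) (U₀ : Site d → Fin d → 𝔸ˣ) (A : Site d → Fin d → 𝔸) : ℝ :=
  bondNorm L m η (-(3 : ℝ)) (fun _ => (Set.univ : Set (Site d))) (fun x μ => Jcur η U₀ A μ x)
    + wsup 1 (fun p : {p : ℕ × (Site d × Fin d) // p.1 ≤ m ∧ p.2 ∈ bondsOn (torusLam m) p.1} =>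
        linCovIter L U₀ (iEta η A) p.1.1 p.1.2.1 p.1.2.2)

/-- **THE LANDAU LETTER CARRIED BY THE TORUS INDUCTION** for a gauge-fixed field `W = U′^{u⁻¹}` at `m` levels: (1.38) «R(U₀)D^{η*}_{U₀}A = 0»
for `A = (1/iη) log W` in the multiplier form of record (`B8Eq138LandauZd.IsLandau138W`, Dirichlet domain `Ω₀ = T_η`, constraint sets
`torusLam m`), TOGETHER WITH the induction's own datum re-exposed: `W = U′^{u⁻¹}` for some `G`-valued `P`-periodic `u` with (1.29) at `m`
levels.  The second clause carries no printed content; it lets the `ℤᵈ` engines (`B8Prop3GaugeFixedKLevel.hP3_gaugeFixed_of_b9`,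
`B8Thm2GaugeFixedKLevel.thm2_norms_gaugeFixed_kLevel`, whose Landau predicate `Lan` is ARBITRARY) hand the torus sockets below a
`G`-valued periodic gauge. [cite: Balaban1985RegularSpaces, (1.38) p.82, (1.29) p.81, (1.17) p.78] -/
def LanT (L : ℕ) (P : ℤ) (η : ℝ) (G : Subgroup 𝔸ˣ) (U₀ U' : Site d → Fin d → 𝔸ˣ) (m : ℕ) (W : Site d → Fin d → 𝔸ˣ) : Prop :=
  IsLandau138W L m η (Set.univ : Set (Site d)) (torusLam m) U₀ W ∧
    ∃ u : Site d → 𝔸ˣ, (∀ x, u x ∈ G) ∧ (∀ (x : Site d) (i : Fin d), u (x + P • e i) = u x) ∧ mgauge U₀ u W = U' ∧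
      Restr129 L m (torusLam m) U₀ u

/-- **SOCKET — PROPOSITION 5 (p. 94, existence (1.107)–(1.108)) AT THE FIRST STEP** («A proof of the first step, for k = 1, will be
included in a proof of the general step … They are satisfied in the case k = 1 also, if we take u₁ = 1, U′ = U₁», pp. 88–89), ON THE TORUS:
for the base datum `u₁ = 1`, `U₁ = U′` there are a `G`-valued `P`-periodic `v = e^{iλ}` with (1.108) `|λ|, |Dλ|₍₋₁₎ ≤ α₄` (`α₄ =
8B′₀B₁(α₀ + α₁)`; the level-`1` weight `Lη`) solving (1.107): `U′^{v⁻¹}` is in the Landau gauge of level `1` and `v` satisfies (1.29) at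
level `1` (`torusLam 1`).  Hypothesis shape, asserted for nothing (Sects. C–E at one level). [cite: Balaban1985RegularSpaces, Prop. 5 (1.107)–(1.108) p.94, pp.88–89] -/
def SockP5Base (L : ℕ) (P : ℤ) (η α₄ : ℝ) (G : Subgroup 𝔸ˣ) (U₀ U' : Site d → Fin d → 𝔸ˣ) : Prop :=
  ∃ (v : Site d → 𝔸ˣ) (lam : Site d → 𝔸), (∀ x, v x ∈ G) ∧ (∀ (x : Site d) (i : Fin d), v (x + P • e i) = v x) ∧
    (∀ x, ((v x : 𝔸ˣ) : 𝔸) = ((gaugeExp lam x : 𝔸ˣ) : 𝔸)) ∧ (∀ x, ‖lam x‖ ≤ α₄) ∧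
    (∀ (x : Site d) (κ : Fin d), ((L : ℝ) ^ 1 * η) * ‖covDerivFwd η U₀ κ lam x‖ ≤ α₄) ∧
    IsLandau138W L 1 η (Set.univ : Set (Site d)) (torusLam 1) U₀ (mgauge U₀ v⁻¹ U') ∧ Restr129 L 1 (torusLam 1) U₀ v

/-- **SOCKET — PROPOSITION 5 (p. 94, existence (1.107)–(1.108)) AT LEVEL `m + 1` FOR THE LEVEL-`m` DATUM OF THEOREM 4's INDUCTION**, ON THE
TORUS: for `(u₁, U₁ = U′^{u₁⁻¹}, A)` with `u₁` `G`-valued `P`-periodic, (1.68) = (1.29) at `m` levels (`torusLam m`: on the torus print's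
`Λ′_{k−1} = Λ_{k−1} ∪ B(Λ_k)` is all of `T^{(m)}`), `U₁` in the Landau gauge of level `m`, and (1.69) `U₁ = e^{iηA}`, `A` self-adjoint, `|A| ≤
c⋆(Lᵐη)⁻¹` (`c⋆ = B₁(α₀ + α₁)`): there are a `G`-valued `P`-periodic `v = e^{iλ}` with (1.108) `|λ|, (L^{m+1}η)|Dλ| ≤ α₄` solving (1.107) at
level `m + 1` — `U₁^{v⁻¹}` Landau at `m + 1` levels, `u₁v` with (1.29) at `m + 1` levels.  Hypothesis shape, asserted for nothing; the
gradient member of (1.69) and `u₁`'s (1.73)–(1.74), which Proposition 5 also consumes, are its provider's to derive (Prop. 3, `B8Eq106Local`).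
[cite: Balaban1985RegularSpaces, Prop. 5 (1.107)–(1.108) p.94, (1.68)–(1.69) p.88] -/
def SockP5Step (L : ℕ) (P : ℤ) (η cstar α₄ : ℝ) (G : Subgroup 𝔸ˣ) (U₀ U' : Site d → Fin d → 𝔸ˣ) (m : ℕ) : Prop :=
  ∀ (u₁ : Site d → 𝔸ˣ) (U₁ : Site d → Fin d → 𝔸ˣ) (A : Site d → Fin d → 𝔸),
    (∀ x, u₁ x ∈ G) → (∀ (x : Site d) (i : Fin d), u₁ (x + P • e i) = u₁ x) →
    mgauge U₀ u₁ U₁ = U' → Restr129 L m (torusLam m) U₀ u₁ → IsLandau138W L m η (Set.univ : Set (Site d)) (torusLam m) U₀ U₁ →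
    (∀ (x : Site d) (κ : Fin d), U₁ x κ = cfgExp η A x κ ∧ IsSelfAdjoint (A x κ) ∧ ‖A x κ‖ ≤ cstar * ((L : ℝ) ^ m * η)⁻¹) →
    ∃ (v : Site d → 𝔸ˣ) (lam : Site d → 𝔸), (∀ x, v x ∈ G) ∧ (∀ (x : Site d) (i : Fin d), v (x + P • e i) = v x) ∧
      (∀ x, ((v x : 𝔸ˣ) : 𝔸) = ((gaugeExp lam x : 𝔸ˣ) : 𝔸)) ∧ (∀ x, ‖lam x‖ ≤ α₄) ∧
      (∀ (x : Site d) (κ : Fin d), ((L : ℝ) ^ (m + 1) * η) * ‖covDerivFwd η U₀ κ lam x‖ ≤ α₄) ∧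
      IsLandau138W L (m + 1) η (Set.univ : Set (Site d)) (torusLam (m + 1)) U₀ (mgauge U₀ v⁻¹ U₁) ∧
      Restr129 L (m + 1) (torusLam (m + 1)) U₀ (u₁ * v)

/-- **SOCKET — THE (1.42) CLAUSE «|Q_j(U₀, ηA)| < 2dLα₁ on Λ_j»** for a gauge-fixed field at `m` levels on the torus (`Λ_j = ∅` below `m`,
`Λ_m = T^{(m)}`): for `(u, W = U′^{u⁻¹}, A)` with `u` `G`-valued `P`-periodic, (1.29), (1.38) and `W = e^{iηA}`, `A` self-adjoint, `|A| ≤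
g(Lᵐη)⁻¹`: `|Q_m(U₀, ηA)(c)| < 2dLα₁` at every level-`m` bond `c` (`B7Prop4GeneralLevels.logCovIter`, the composite (127) of [3]).  In print
this is (1.37) «Q_j(U₀, ηA) = B, B is given by formula (1.31) with V′ = Ũ′ʲ, |B| < 2dLα₁ by the assumption (1.35)» — «basically of an
algebraic character and it follows from the construction, as in (1.30), (1.31)» (p. 83); at the TOP level `m = k` the constant is the `α₁` of
(1.35), at the intermediate levels `m < k` of Theorem 4's induction it is the renamed `α₁ = 11d²α₀ + α₁` of (1.66) (the parameter `α₁` of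
this shape is instantiated accordingly in `Thm2TorusSockets`).  The tree has the clause in [3] Prop. 4's global regime (`B8Eq137QjEqB`); here
a hypothesis shape, as in the `ℤᵈ` twin (`B8Thm2GaugeFixedKLevel`, hypotheses `H42`∕`H42′`). [cite: Balaban1985RegularSpaces, (1.42) p.83, (1.37) p.82, p.83, (1.66) p.87] -/
def Sock142 (L : ℕ) (P : ℤ) (η α₁ g : ℝ) (G : Subgroup 𝔸ˣ) (U₀ U' : Site d → Fin d → 𝔸ˣ) (m : ℕ) : Prop :=
  ∀ (u : Site d → 𝔸ˣ) (W : Site d → Fin d → 𝔸ˣ) (A : Site d → Fin d → 𝔸),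
    (∀ x, u x ∈ G) → (∀ (x : Site d) (i : Fin d), u (x + P • e i) = u x) →
    mgauge U₀ u W = U' → Restr129 L m (torusLam m) U₀ u → IsLandau138W L m η (Set.univ : Set (Site d)) (torusLam m) U₀ W →
    (∀ (x : Site d) (κ : Fin d), IsSelfAdjoint (A x κ)) → (∀ (x : Site d) (κ : Fin d), W x κ = cfgExp η A x κ) →
    (∀ (x : Site d) (κ : Fin d), ‖A x κ‖ ≤ g * ((L : ℝ) ^ m * η)⁻¹) →
    ∀ (x : Site d) (ν : Fin d), ‖logCovIter L U₀ (iEta η A) m x ν‖ < 2 * d * L * α₁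

/-- A larger constant `α₁ ≤ α₁′` weakens the (1.42) clause. [cite: Balaban1985RegularSpaces, (1.42) p.83] -/
theorem sock142_mono {L : ℕ} {P : ℤ} {η α₁ α₁' g : ℝ} {G : Subgroup 𝔸ˣ} {U₀ U' : Site d → Fin d → 𝔸ˣ} {m : ℕ} (hα : α₁ ≤ α₁')
    (h : Sock142 L P η α₁ g G U₀ U' m) : Sock142 L P η α₁' g G U₀ U' m := by
  intro u W A huG huP hW h129 hLan hsa hWe hbd x ν
  exact (h u W A huG huP hW h129 hLan hsa hWe hbd x ν).trans_le (mul_le_mul_of_nonneg_left hα (by positivity))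

/-- **THE FIVE LINES OF (1.59) AT `m` LEVELS ON THE TORUS, READ POINTWISE** («|A|₍₋₁₎, |∇^η_{U₀}A|₍₋₂₎, |Δ^η_{U₀}A|₍₋₃₎, ‖A‖_{1,β,(−2−β)}
≦ B₀(|J|₍₋₃₎ + |B₁|)», p. 86; the printed weighted suprema over the all-torus sequence `Ω_j = T_η` are attained at `j = m`), with `N = rhs159 L m η
U₀ A`: `(Lᵐη)|A(b)| ≤ B₀N`, `(Lᵐη)²|(D^η_{U₀,μ}A_κ)(x)| ≤ B₀N` (`B8Ineq132.covDerivFwd`), `(Lᵐη)³|(D^{η*}_{U₀}D^η_{U₀}A)(b)| ≤ B₀N`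
(`B8Eq143PlaqExpansion.pdiv ∘ B8Eq146AExpansion.plaqCovDeriv`, [4] (3.4)), `(Lᵐη)³|(Δ^η_{U₀}A_κ)(x)| ≤ B₀N` (`B8Eq138LandauZd.covLap`, componentwise
— the reading of record of `B8Thm2TorusAt.C139T`), and the Hölder line `(Lᵐη)^{2+β}·q_β(D^η_{U₀,μ}A_κ)(x, x′) ≤ B₀(β₀)N` for `0 ≤ β ≤ β₀` on the
admissible pairs of [4] (3.40) (`B9Eq340HolderZd.hquot`/`AdmPair`, length function `len`). [cite: Balaban1985RegularSpaces, (1.59) p.86; Balaban1985BackgroundPropagators, Thm 3.3 p.397, (3.4) p.390, (3.40) p.397] -/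
def Lines159 (L m : ℕ) (η β₀ B₀ B₀β : ℝ) (len : Site d → ℝ) (U₀ : Site d → Fin d → 𝔸ˣ) (A : Site d → Fin d → 𝔸) : Prop :=
  (∀ (x : Site d) (κ : Fin d), ((L : ℝ) ^ m * η) * ‖A x κ‖ ≤ B₀ * rhs159 L m η U₀ A) ∧
    (∀ (x : Site d) (μ κ : Fin d), ((L : ℝ) ^ m * η) ^ 2 * ‖covDerivFwd η U₀ μ (fun z => A z κ) x‖ ≤ B₀ * rhs159 L m η U₀ A) ∧
    (∀ (x : Site d) (μ : Fin d), ((L : ℝ) ^ m * η) ^ 3 * ‖pdiv η U₀ (plaqCovDeriv η U₀ A) μ x‖ ≤ B₀ * rhs159 L m η U₀ A) ∧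
    (∀ (x : Site d) (κ : Fin d), ((L : ℝ) ^ m * η) ^ 3 * ‖covLap η U₀ (fun z => A z κ) x‖ ≤ B₀ * rhs159 L m η U₀ A) ∧
    (∀ β : ℝ, 0 ≤ β → β ≤ β₀ → ∀ (μ κ : Fin d) (q : Site d × Site d), q ∈ AdmPair η len →
      ((L : ℝ) ^ m * η) ^ (2 + β) * hquot η β len U₀ (covDerivFwd η U₀ μ (fun z => A z κ)) q ≤ B₀β * rhs159 L m η U₀ A)

/-- **SOCKET — THE IN-EDGE (1.59) = THEOREM 3.3 OF [4]** («Theorem 3.3 of [4] implies the bounds |A|₍₋₁₎, |∇^η_{U₀}A|₍₋₂₎, |Δ^η_{U₀}A|₍₋₃₎,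
‖A‖_{1,β,(−2−β)} ≦ B₀(|J|₍₋₃₎ + |B₁|)», p. 86, from the representation (1.57)–(1.58) of a field in the Landau gauge with (1.29)) for a gauge-fixed
field at `m` levels on the torus: for `(u, W = U′^{u⁻¹}, A)` as in `Sock142` (guard `g`), the five lines `Lines159`.  Hypothesis shape,
asserted for nothing (the DAG in-edge b9 of the `ℤᵈ` twin — its `H59`/`H59full` —, NOT provable inside [B8]). [cite: Balaban1985RegularSpaces, (1.59) p.86, (1.57)–(1.58) p.86; Balaban1985BackgroundPropagators, Thm 3.3 p.397] -/
def Sock159 (L : ℕ) (P : ℤ) (η β₀ B₀ B₀β g : ℝ) (len : Site d → ℝ) (G : Subgroup 𝔸ˣ) (U₀ U' : Site d → Fin d → 𝔸ˣ)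
    (m : ℕ) : Prop :=
  ∀ (u : Site d → 𝔸ˣ) (W : Site d → Fin d → 𝔸ˣ) (A : Site d → Fin d → 𝔸),
    (∀ x, u x ∈ G) → (∀ (x : Site d) (i : Fin d), u (x + P • e i) = u x) →
    mgauge U₀ u W = U' → Restr129 L m (torusLam m) U₀ u → IsLandau138W L m η (Set.univ : Set (Site d)) (torusLam m) U₀ W →
    (∀ (x : Site d) (κ : Fin d), IsSelfAdjoint (A x κ)) → (∀ (x : Site d) (κ : Fin d), W x κ = cfgExp η A x κ) →
    (∀ (x : Site d) (κ : Fin d), ‖A x κ‖ ≤ g * ((L : ℝ) ^ m * η)⁻¹) →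
    Lines159 L m η β₀ B₀ B₀β len U₀ A

/-- **SOCKET — PROPOSITION 5, THE UNIQUENESS CLAUSE (1.109)** («Such a configuration u′ is unique in the domain |λ|, |Dλ|₍₋₁₎ < c₃», p. 94) FOR
A LEVEL-`k` SOLUTION DATUM `(U₀, U₁ = e^{iηA₁}, u₁)` OF THEOREM 2 on the torus (`u₁` `G`-valued `P`-periodic with (1.29), `U′ = U₁^{u₁}`, `A₁`
self-adjoint with (1.36)₁ `|A₁| ≤ c_A(Lᵏη)⁻¹` and (1.38)): two `G`-valued `P`-periodic `v = e^{iλ}`, `w = e^{iμ}` with `λ, μ` `𝔤`-valued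
(self-adjoint) in the domain «`|λ| < c_u`, `(Lᵏη)|Dλ| < c_u` at every site ∕ bond» and both solving (1.107) — `U₁^{v⁻¹}` Landau at `k` levels,
(1.29) for `u₁v` — coincide.  The use is print's p. 95: «thus u′ is a solution of the problem described in Proposition 5 … a configuration
identically equal to 1 is a solution also … The uniqueness implies u′ = 1».  Hypothesis shape, asserted for nothing (the `hP5u` of
`B8Thm4UniqueLocal.thm4_unique_local`, all-torus form). [cite: Balaban1985RegularSpaces, Prop. 5 (1.109) p.94, p.95 (after (1.112))] -/
def SockP5Uniq (L k : ℕ) (P : ℤ) (η cA cu : ℝ) (G : Subgroup 𝔸ˣ) (U₀ U' : Site d → Fin d → 𝔸ˣ) : Prop :=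
  ∀ (u₁ : Site d → 𝔸ˣ) (A₁ : Site d → Fin d → 𝔸),
    (∀ x, u₁ x ∈ G) → (∀ (x : Site d) (i : Fin d), u₁ (x + P • e i) = u₁ x) → Restr129 L k (torusLam k) U₀ u₁ →
    mgauge U₀ u₁ (cfgExp η A₁) = U' → (∀ (x : Site d) (κ : Fin d), IsSelfAdjoint (A₁ x κ)) →
    (∀ (x : Site d) (κ : Fin d), ‖A₁ x κ‖ ≤ cA * ((L : ℝ) ^ k * η)⁻¹) →
    IsLandau138 L k η (Set.univ : Set (Site d)) (torusLam k) U₀ A₁ →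
    ∀ (v w : Site d → 𝔸ˣ) (lam mu : Site d → 𝔸),
      (∀ x, v x ∈ G) → (∀ (x : Site d) (i : Fin d), v (x + P • e i) = v x) →
      (∀ x, w x ∈ G) → (∀ (x : Site d) (i : Fin d), w (x + P • e i) = w x) →
      (∀ x, ((gaugeExp lam x : 𝔸ˣ) : 𝔸) = ((v x : 𝔸ˣ) : 𝔸) ∧ IsSelfAdjoint (lam x) ∧ ‖lam x‖ < cu ∧
        ∀ κ : Fin d, ((L : ℝ) ^ k * η) * ‖covDerivFwd η U₀ κ lam x‖ < cu) →
      (∀ x, ((gaugeExp mu x : 𝔸ˣ) : 𝔸) = ((w x : 𝔸ˣ) : 𝔸) ∧ IsSelfAdjoint (mu x) ∧ ‖mu x‖ < cu ∧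
        ∀ κ : Fin d, ((L : ℝ) ^ k * η) * ‖covDerivFwd η U₀ κ mu x‖ < cu) →
      IsLandau138W L k η (Set.univ : Set (Site d)) (torusLam k) U₀ (mgauge U₀ v⁻¹ (cfgExp η A₁)) →
      Restr129 L k (torusLam k) U₀ (u₁ * v) →
      IsLandau138W L k η (Set.univ : Set (Site d)) (torusLam k) U₀ (mgauge U₀ w⁻¹ (cfgExp η A₁)) →
      Restr129 L k (torusLam k) U₀ (u₁ * w) → v = w

end Sockets

/-! ## §4 Adapters: the torus sockets in the currency of the `ℤᵈ` engines (`Ω_j := T_η`, `Λs m := torusLam m`, `Λb m := bondsOn (torusLam m)`,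
`E j := SideTouches T_η` = every bond, `Lan := LanT`) -/

section Adapters

variable {𝔸 : Type*} [CStarAlgebra 𝔸]
variable {L k : ℕ} {P : ℤ} {η : ℝ} {G : Subgroup 𝔸ˣ} {U₀ U' : Site d → Fin d → 𝔸ˣ}

/-- The right side of (1.59) is non-negative (real `iSup` conventions of `B8ScaledSupNorm.msup`, `B8Eq155JBound.wsup`).
[cite: Balaban1985RegularSpaces, (1.59) p.86] -/
theorem rhs159_nonneg (L m : ℕ) {η : ℝ} (hη : 0 ≤ η) (U₀ : Site d → Fin d → 𝔸ˣ) (A : Site d → Fin d → 𝔸) :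
    0 ≤ rhs159 L m η U₀ A :=
  add_nonneg (B8ScaledSupNorm.msup_nonneg L m hη _ _ _) (B8Eq155JBound.wsup_nonneg zero_le_one _)

/-- A bound at the weight `(Lᵐη)⁻ᵖ` is a bound at every weight `(Lʲη)⁻ᵖ`, `j ≤ m` (`L ≥ 1`): the all-torus sup-norms are attained at the top
level. [cite: Balaban1985RegularSpaces, p.86 (definition after (1.55))] -/
theorem bound_anti_level (hL1 : 1 ≤ L) (hη : 0 < η) {c : ℝ} (hc : 0 ≤ c) {j m : ℕ} (hjm : j ≤ m) (p : ℕ) :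
    c * (((L : ℝ) ^ m * η)⁻¹) ^ p ≤ c * (((L : ℝ) ^ j * η)⁻¹) ^ p := by
  have hLr : (1 : ℝ) ≤ L := by exact_mod_cast hL1
  have hj0 : 0 < (L : ℝ) ^ j * η := B8ScaledSupNorm.scale_pos hL1 hη j
  have hle : (L : ℝ) ^ j * η ≤ (L : ℝ) ^ m * η := mul_le_mul_of_nonneg_right (pow_le_pow_right₀ hLr hjm) hη.le
  apply mul_le_mul_of_nonneg_left _ hc
  exact pow_le_pow_left₀ (by positivity) ((inv_le_inv₀ (by positivity) hj0).2 hle) p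

/-- `c(Lᵐη)⁻¹ ≤ c(Lʲη)⁻¹` for `j ≤ m` (the top-level bound is the binding one on the torus). [cite: Balaban1985RegularSpaces, p.86 (definition after (1.55))] -/
theorem bound_anti_level₁ (hL1 : 1 ≤ L) (hη : 0 < η) {c : ℝ} (hc : 0 ≤ c) {j m : ℕ} (hjm : j ≤ m) :
    c * ((L : ℝ) ^ m * η)⁻¹ ≤ c * ((L : ℝ) ^ j * η)⁻¹ := by
  have h := bound_anti_level hL1 hη hc hjm 1
  rwa [pow_one, pow_one] at h

/-- The weight grows with the level: `(Lʲη)ᵖ·t ≤ (Lᵐη)ᵖ·t` for `j ≤ m`, `t ≥ 0`. [cite: Balaban1985RegularSpaces, p.86 (definition after (1.55))] -/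
theorem weight_mono_level (hL1 : 1 ≤ L) (hη : 0 < η) {j m : ℕ} (hjm : j ≤ m) (p : ℕ) {t : ℝ} (ht : 0 ≤ t) :
    ((L : ℝ) ^ j * η) ^ p * t ≤ ((L : ℝ) ^ m * η) ^ p * t := by
  have hLr : (1 : ℝ) ≤ L := by exact_mod_cast hL1
  have hle : (L : ℝ) ^ j * η ≤ (L : ℝ) ^ m * η := mul_le_mul_of_nonneg_right (pow_le_pow_right₀ hLr hjm) hη.le
  exact mul_le_mul_of_nonneg_right (pow_le_pow_left₀ (by positivity) hle p) ht

/-- **The (1.42) socket in the `ℤᵈ` engines' currency** (hypothesis `H42` of `B8Prop3GaugeFixedKLevel.hP3_gaugeFixed_of_b9` ∕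
`B8Thm2GaugeFixedKLevel.thm2_norms_gaugeFixed_kLevel` at `Ω_j = T_η`, `Λs = torusLam`, `Λb m = bondsOn (torusLam m)`, `Lan = LanT`): the
engine's unitary gauge is discarded for the `G`-valued periodic one carried by `LanT`; the constant `α₁ᵉ` is print's renamed
`11d²α₀ + α₁` (p. 87). [cite: Balaban1985RegularSpaces, (1.42) p.83, p.87 («let us write α₁ instead of the right-hand side»)] -/
theorem h42_engine (hd2 : 2 ≤ d) {α₁e g : ℝ}
    (h42 : ∀ m, 1 ≤ m → m ≤ k → Sock142 L P η α₁e g G U₀ U' m) :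
    ∀ m, 1 ≤ m → m ≤ k → ∀ (u : Site d → 𝔸ˣ) (W : Site d → Fin d → 𝔸ˣ) (A' : Site d → Fin d → 𝔸),
      (∀ x, u x ∈ unitaryUnits 𝔸) → mgauge U₀ u W = U' → Restr129 L m (torusLam m) U₀ u → LanT L P η G U₀ U' m W →
      (∀ y τ, IsSelfAdjoint (A' y τ)) →
      (∀ j, j ≤ m → ∀ y τ, SideTouches (Set.univ : Set (Site d)) y τ →
        W y τ = cfgExp η A' y τ ∧ ‖A' y τ‖ ≤ g * ((L : ℝ) ^ j * η)⁻¹) →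
      (∀ y τ, (∀ j, j ≤ m → ¬ SideTouches (Set.univ : Set (Site d)) y τ) → A' y τ = 0) →
      ∀ j, j ≤ m → ∀ c ∈ bondsOn (torusLam m) j, ‖logCovIter L U₀ (iEta η A') j c.1 c.2‖ < 2 * d * L * α₁e := by
  intro m hm1 hmk _ W A' _ _ _ hLan hsa hWA _ j _ c hc
  obtain ⟨h138, u', hu'G, hu'P, hu'W, hu'R⟩ := hLan
  obtain rfl : j = m := eq_of_mem_bondsOn_torusLam hc
  have hWe : ∀ (x : Site d) (κ : Fin d), W x κ = cfgExp η A' x κ := fun x κ => (hWA j le_rfl x κ (sideTouches_univ hd2 x κ)).1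
  have hbd : ∀ (x : Site d) (κ : Fin d), ‖A' x κ‖ ≤ g * ((L : ℝ) ^ j * η)⁻¹ :=
    fun x κ => (hWA j le_rfl x κ (sideTouches_univ hd2 x κ)).2
  exact h42 j hm1 hmk u' W A' hu'G hu'P hu'W hu'R h138 hsa hWe hbd c.1 c.2

/-- **The (1.59) socket in the `ℤᵈ` engines' currency, first and gradient lines** (hypothesis `H59` of
`B8Prop3GaugeFixedKLevel.hP3_gaugeFixed_of_b9`): the pointwise lines at the top weight `(Lᵐη)ᵖ` bound the engines' weighted suprema
`|A′|₍₋₁₎`, `|∇^η_{U₀}A′|₍₋₂₎` over the all-torus sequence (`B8ScaledSupNorm.msup_le`). [cite: Balaban1985RegularSpaces, (1.59) p.86, p.86 (definition after (1.55))] -/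
theorem h59_engine (hd2 : 2 ≤ d) (hL1 : 1 ≤ L) (hη : 0 < η) {β₀ B₀ B₀β g : ℝ} {len : Site d → ℝ} (hB₀ : 0 ≤ B₀)
    (h59 : ∀ m, 1 ≤ m → m ≤ k → Sock159 L P η β₀ B₀ B₀β g len G U₀ U' m) :
    ∀ m, 1 ≤ m → m ≤ k → ∀ (u : Site d → 𝔸ˣ) (W : Site d → Fin d → 𝔸ˣ) (A' : Site d → Fin d → 𝔸),
      (∀ x, u x ∈ unitaryUnits 𝔸) → mgauge U₀ u W = U' → Restr129 L m (torusLam m) U₀ u → LanT L P η G U₀ U' m W →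
      (∀ y τ, IsSelfAdjoint (A' y τ)) →
      (∀ j, j ≤ m → ∀ y τ, SideTouches (Set.univ : Set (Site d)) y τ →
        W y τ = cfgExp η A' y τ ∧ ‖A' y τ‖ ≤ g * ((L : ℝ) ^ j * η)⁻¹) →
      (∀ y τ, (∀ j, j ≤ m → ¬ SideTouches (Set.univ : Set (Site d)) y τ) → A' y τ = 0) →
      msup L m η (-(1 : ℝ)) (fun j (b : Site d × Fin d) => SideTouches ((fun _ => (Set.univ : Set (Site d))) j) b.1 b.2)
          (fun b => A' b.1 b.2) ≤ B₀ * rhs159 L m η U₀ A' ∧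
        msup L m η (-(2 : ℝ)) (fun j (t : Fin d × Fin d × Site d) => SideTouches ((fun _ => (Set.univ : Set (Site d))) j) t.2.2 t.2.1)
          (fun t => covDerivFwd η U₀ t.1 (fun z => A' z t.2.1) t.2.2) ≤ B₀ * rhs159 L m η U₀ A' := by
  intro m hm1 hmk _ W A' _ _ _ hLan hsa hWA _
  obtain ⟨h138, u', hu'G, hu'P, hu'W, hu'R⟩ := hLan
  have hWe : ∀ (x : Site d) (κ : Fin d), W x κ = cfgExp η A' x κ := fun x κ => (hWA m le_rfl x κ (sideTouches_univ hd2 x κ)).1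
  have hbd : ∀ (x : Site d) (κ : Fin d), ‖A' x κ‖ ≤ g * ((L : ℝ) ^ m * η)⁻¹ :=
    fun x κ => (hWA m le_rfl x κ (sideTouches_univ hd2 x κ)).2
  obtain ⟨ha, hg, -, -, -⟩ := h59 m hm1 hmk u' W A' hu'G hu'P hu'W hu'R h138 hsa hWe hbd
  have hN : 0 ≤ B₀ * rhs159 L m η U₀ A' := mul_nonneg hB₀ (rhs159_nonneg L m hη.le U₀ A')
  refine ⟨B8ScaledSupNorm.msup_le hN fun j hj b _ => ?_, B8ScaledSupNorm.msup_le hN fun j hj t _ => ?_⟩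
  · have e1 : (-(1 : ℝ)) = -((1 : ℕ) : ℝ) := by norm_num
    rw [e1, B8ScaledSupNorm.weight_neg_natCast L η 1 j]
    exact (weight_mono_level hL1 hη hj 1 (norm_nonneg _)).trans (by rw [pow_one]; exact ha b.1 b.2)
  · have e2 : (-(2 : ℝ)) = -((2 : ℕ) : ℝ) := by norm_num
    rw [e2, B8ScaledSupNorm.weight_neg_natCast L η 2 j]
    exact (weight_mono_level hL1 hη hj 2 (norm_nonneg _)).trans (hg t.2.2 t.1 t.2.1)

end Adapters

/-! ## §5 Theorem 4's induction on the torus (p. 88 «let us assume that Theorem 4 holds for some k − 1 and we will prove it for k»; pp. 94–95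
«It gives us a gauge transformation u = u′u₁ … Thus all the assumptions of Proposition 3 are satisfied»), carrying `u` `G`-VALUED AND
`P`-PERIODIC — the torus twin of `B8Thm4InductionLocal.thm4_exists_all_levels` ∘ `B8Prop3GaugeFixedKLevel.thm4_exists_all_levels_of_b9` -/

section Driver

variable {𝔸 : Type*} [CStarAlgebra 𝔸] [Nontrivial 𝔸]
variable {L k : ℕ} {P : ℤ} {η : ℝ} {G : Subgroup 𝔸ˣ} {U₀ U' : Site d → Fin d → 𝔸ˣ}

/-- **THEOREM 4, EXISTENCE CLAUSE, BY INDUCTION ON THE NUMBER OF LEVELS, ON THE TORUS `Ω_j = T_η` WITH A `G`-VALUED `P`-PERIODIC GAUGE —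
MODULO PROPOSITION 5 (sockets `SockP5Base`, `SockP5Step`), THE IN-EDGE (1.59) (`Sock159`) AND THE (1.42) CLAUSE (`Sock142`).**  Data: a gauge
group `G ≤ U(𝔸)`, `G`-valued `P`-periodic `U₀`, `U′` with (1.33)∕(1.34) `U₀, U′U₀ ∈ 𝔄_k({T_η}, α₀)` and the base smallness (1.66)₀ `‖U′_b − 1‖ ≤ a`
(`a ≤ 1/4`, `2a ≤ c⋆`, p. 89 «at least for B₁ not too small»); constants `c⋆ = 5dLB₀(α₀ + α₁ᵉ)` (`α₁ᵉ ≥ α₁`: print's renamed `11d²α₀ + α₁`,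
p. 87), `α₄` of (1.108), windows of the `ℤᵈ` engine at the guard `2Lc⋆ + 8α₄` of (1.110)–(1.111).  CONCLUSION: for every `m ≤ k` a `G`-valued
`P`-periodic `u` with (1.29) at `m` levels (`torusLam m`) whose `W = U′^{u⁻¹}` is in the Landau gauge (1.38) of level `m` (`m ≥ 1`) and
satisfies `W = e^{iηA}`, `A = (1/iη) log W` self-adjoint, `|A| ≤ c⋆(Lᵐη)⁻¹`.  PROOF = print's: base datum `u = 1`, `W = U′`
(`B8Thm4TruncationLocal.base_datum`); step `u ↦ u·v`, `W ↦ W^{v⁻¹}` with Proposition 5's `v = e^{iλ}` ((1.110) at every bond,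
`B8Thm4ExistsLocal.bond_1110_local`), then the reset `2Lc⋆ + 8α₄ ↦ c⋆` by Proposition 3, first member, BY NAME
(`B8Prop3GaugeFixedKLevel.hP3_gaugeFixed_of_b9` with `Lan := LanT`, its `H42`∕`H59` served by `h42_engine`∕`h59_engine`).  HONEST SCOPE:
Propositions 3∕5, (1.59), (1.42) are hypotheses∕by name; count-neutral. [cite: Balaban1985RegularSpaces, Thm 4 p.88, pp.88–89, Prop. 5 (1.107)–(1.108) p.94, (1.110)–(1.111) p.95, Prop. 3 p.87] -/
theorem torus_all_levels (hd2 : 2 ≤ d) (hη : 0 < η) (hL : 2 ≤ L) (hG : G ≤ unitaryUnits 𝔸)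
    (hU₀ : ∀ x κ, U₀ x κ ∈ G) (hU' : ∀ x κ, U' x κ ∈ G)
    {α₀ α₁e α₄ β₀ B₀ B₀β cstar a : ℝ} {len : Site d → ℝ}
    (hα₀ : 0 < α₀) (hα₁e : 0 ≤ α₁e) (hα₄ : 0 ≤ α₄) (hB₀ : 0 ≤ B₀)
    (hc : cstar = 5 * d * L * B₀ * (α₀ + α₁e))
    (hs₁ : α₄ ≤ 1 / 84) (hs₂ : L * cstar ≤ 1 / 12) (ha : a ≤ 1 / 4) (ha2 : 2 * a ≤ cstar)
    (hα3 : C0 d * α₀ ≤ 1 / 3) (hα4 : 4 * α₀ ≤ c2' d L)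
    (h16 : 16 * (2 * (L * cstar) + 8 * α₄) ≤ 1) (hd5 : 5 * (2 * (L * cstar) + 8 * α₄) * ((d : ℝ) - 1) ≤ 4)
    (hsmall : Real.exp (4 * (800 * ((d : ℝ) + 1) ^ 2 * ((d : ℝ) + 4)) * α₀)
      * (1 + 8 * (131072 * ((d : ℝ) + 1) ^ 2) * (2 * (L * cstar) + 8 * α₄)) ≤ 2)
    (hc₃ : 2 * (2 * (L * cstar) + 8 * α₄) ≤ c3 d L) (hside : 36 * d * B₀ * (2 * (L * cstar) + 8 * α₄) ≤ 1 / 2)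
    (h50 : 50 * d * (2 * (L * cstar) + 8 * α₄) ≤ 1)
    {C₂ : ℝ} (hC₂ : 8 * (131072 * ((d : ℝ) + 1) ^ 2) * Real.exp (4 * (800 * ((d : ℝ) + 1) ^ 2 * ((d : ℝ) + 4)) * α₀) ≤ C₂)
    (h61 : 2 * (2 * (L * cstar) + 8 * α₄) ^ 2 + 20 * d * α₀ * (2 * (L * cstar) + 8 * α₄)
      + 2 * C₂ * (2 * (L * cstar) + 8 * α₄) ^ 2 ≤ α₀ + α₁e)
    (h33 : InAk L k η α₀ (fun _ => (Set.univ : Set (Site d))) U₀)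
    (h34 : InAk L k η α₀ (fun _ => (Set.univ : Set (Site d))) (U' * U₀))
    (h66 : ∀ (x : Site d) (κ : Fin d), ‖((U' x κ : 𝔸ˣ) : 𝔸) - 1‖ ≤ a)
    (hP5base : SockP5Base L P η α₄ G U₀ U')
    (hP5 : ∀ m, 1 ≤ m → m < k → SockP5Step L P η cstar α₄ G U₀ U' m)
    (h42 : ∀ m, 1 ≤ m → m ≤ k → Sock142 L P η α₁e (2 * (L * cstar) + 8 * α₄) G U₀ U' m)
    (h59 : ∀ m, 1 ≤ m → m ≤ k → Sock159 L P η β₀ B₀ B₀β (2 * (L * cstar) + 8 * α₄) len G U₀ U' m) :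
    ∀ m, m ≤ k → ∃ (u : Site d → 𝔸ˣ) (W : Site d → Fin d → 𝔸ˣ),
      (∀ x, u x ∈ G) ∧ (∀ (x : Site d) (i : Fin d), u (x + P • e i) = u x) ∧ Restr129 L m (torusLam m) U₀ u ∧
      mgauge U₀ u W = U' ∧ (1 ≤ m → IsLandau138W L m η (Set.univ : Set (Site d)) (torusLam m) U₀ W) ∧
      ∀ (x : Site d) (κ : Fin d), W x κ = cfgExp η (logCfg η W) x κ ∧ IsSelfAdjoint (logCfg η W x κ) ∧
        ‖logCfg η W x κ‖ ≤ cstar * ((L : ℝ) ^ m * η)⁻¹ := by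
  have hL1 : 1 ≤ L := le_trans (by norm_num) hL
  have hLr : (1 : ℝ) ≤ L := by exact_mod_cast hL1
  have hcstar : 0 ≤ cstar := by rw [hc]; positivity
  have hg0 : 0 ≤ 2 * (L * cstar) + 8 * α₄ := by positivity
  have hU₀u : ∀ x κ, U₀ x κ ∈ unitaryUnits 𝔸 := fun x κ => hG (hU₀ x κ)
  have hU'u : ∀ x κ, U' x κ ∈ unitaryUnits 𝔸 := fun x κ => hG (hU' x κ)
  -- Proposition 3 (first member) for the gauge-fixed fields of the induction at every level `m ≤ k`: the `ℤᵈ` engine by name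
  have h34' : InAk L k η α₀ (fun _ => (Set.univ : Set (Site d))) (mulCfg U' U₀) := h34
  have hP3 := B8Prop3GaugeFixedKLevel.hP3_gaugeFixed_of_b9 hd2 hη hL k hU₀u hU'u hα₀ hα₁e hα₄ hB₀ hc hα3 hα4 h16 hd5
    hsmall hc₃ hside h50 hC₂ h61 (fun _ => (Set.univ : Set (Site d))) (fun m => torusLam m) (fun m j => bondsOn (torusLam m) j)
    (fun _ _ _ _ _ _ _ _ => Set.mem_univ _) h33 h34' (LanT L P η G U₀ U') (h42_engine hd2 h42)
    (h59_engine hd2 hL1 hη hB₀ h59)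
  -- THE COMMON TAIL OF A STEP: level-`m` datum + Proposition 5's data at level `m + 1` ⇒ the conclusion at level `m + 1`
  have tail : ∀ m, m < k → ∀ (u₁ : Site d → 𝔸ˣ) (U₁ : Site d → Fin d → 𝔸ˣ),
      (∀ x, u₁ x ∈ G) → (∀ (x : Site d) (i : Fin d), u₁ (x + P • e i) = u₁ x) → mgauge U₀ u₁ U₁ = U' →
      (∀ (x : Site d) (κ : Fin d), U₁ x κ = cfgExp η (logCfg η U₁) x κ ∧ IsSelfAdjoint (logCfg η U₁ x κ) ∧
        ‖logCfg η U₁ x κ‖ ≤ cstar * ((L : ℝ) ^ m * η)⁻¹) →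
      ∀ (v : Site d → 𝔸ˣ) (lam : Site d → 𝔸), (∀ x, v x ∈ G) → (∀ (x : Site d) (i : Fin d), v (x + P • e i) = v x) →
        (∀ x, ((v x : 𝔸ˣ) : 𝔸) = ((gaugeExp lam x : 𝔸ˣ) : 𝔸)) → (∀ x, ‖lam x‖ ≤ α₄) →
        (∀ (x : Site d) (κ : Fin d), ((L : ℝ) ^ (m + 1) * η) * ‖covDerivFwd η U₀ κ lam x‖ ≤ α₄) →
        IsLandau138W L (m + 1) η (Set.univ : Set (Site d)) (torusLam (m + 1)) U₀ (mgauge U₀ v⁻¹ U₁) →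
        Restr129 L (m + 1) (torusLam (m + 1)) U₀ (u₁ * v) →
      ∃ (u : Site d → 𝔸ˣ) (W : Site d → Fin d → 𝔸ˣ),
        (∀ x, u x ∈ G) ∧ (∀ (x : Site d) (i : Fin d), u (x + P • e i) = u x) ∧ Restr129 L (m + 1) (torusLam (m + 1)) U₀ u ∧
        mgauge U₀ u W = U' ∧ (1 ≤ m + 1 → IsLandau138W L (m + 1) η (Set.univ : Set (Site d)) (torusLam (m + 1)) U₀ W) ∧
        ∀ (x : Site d) (κ : Fin d), W x κ = cfgExp η (logCfg η W) x κ ∧ IsSelfAdjoint (logCfg η W x κ) ∧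
          ‖logCfg η W x κ‖ ≤ cstar * ((L : ℝ) ^ (m + 1) * η)⁻¹ := by
    intro m hmk u₁ U₁ hu₁G hu₁P hU₁ hA v lam hvG hvP hvlam hlam hD hLan h129
    -- the new gauge `u = u₁v` and gauge-fixed field `W = U₁^{v⁻¹}`
    set u : Site d → 𝔸ˣ := u₁ * v with hu_def
    set W : Site d → Fin d → 𝔸ˣ := mgauge U₀ v⁻¹ U₁ with hW_def
    have huG : ∀ x, u x ∈ G := fun x => G.mul_mem (hu₁G x) (hvG x)
    have huP : ∀ (x : Site d) (i : Fin d), u (x + P • e i) = u x := by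
      intro x i; simp only [hu_def, Pi.mul_apply, hu₁P, hvP]
    have huu : ∀ x, u x ∈ unitaryUnits 𝔸 := fun x => hG (huG x)
    have hW : mgauge U₀ u W = U' := by
      rw [hW_def, hu_def, B7Eq106Concrete.mgauge_mgauge, mul_assoc, mul_inv_cancel, mul_one, hU₁]
    have hWu : ∀ x κ, W x κ ∈ unitaryUnits 𝔸 := B8Prop3GaugeFixedKLevel.mem_unitaryUnits_of_mgauge_eq hU₀u hU'u huu hW
    -- (1.110) at every bond, weight `t = (L^{m+1}η)⁻¹`, constant `c = Lc⋆`
    have hpos : (0 : ℝ) < (L : ℝ) ^ (m + 1) * η := B8ScaledSupNorm.scale_pos hL1 hη (m + 1)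
    have ht : 0 ≤ ((L : ℝ) ^ (m + 1) * η)⁻¹ := (inv_pos.mpr hpos).le
    have hηt : η * ((L : ℝ) ^ (m + 1) * η)⁻¹ ≤ 1 := by
      have hLj : (1 : ℝ) ≤ (L : ℝ) ^ (m + 1) := one_le_pow₀ hLr
      have e1 : η * ((L : ℝ) ^ (m + 1) * η)⁻¹ = ((L : ℝ) ^ (m + 1))⁻¹ := by field_simp
      rw [e1]; exact inv_le_one_of_one_le₀ hLj
    have hLc : 0 ≤ L * cstar := by positivity
    have hbond : ∀ (x : Site d) (κ : Fin d),
        ‖logCfg η W x κ‖ ≤ (2 * (L * cstar) + 8 * α₄) * ((L : ℝ) ^ (m + 1) * η)⁻¹ ∧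
          cfgExp η (logCfg η W) x κ = W x κ ∧ ‖((W x κ : 𝔸ˣ) : 𝔸) - 1‖ ≤ 1 / 4 := by
      intro x κ
      obtain ⟨hexp, -, hAb⟩ := hA x κ
      have hAb' : ‖logCfg η U₁ x κ‖ ≤ L * cstar * ((L : ℝ) ^ (m + 1) * η)⁻¹ := by
        refine hAb.trans (le_of_eq ?_)
        rw [pow_succ]; field_simp
      have hD' : ‖covDerivFwd η U₀ κ lam x‖ ≤ α₄ * ((L : ℝ) ^ (m + 1) * η)⁻¹ := by
        rw [← div_eq_mul_inv]
        exact (le_div_iff₀' hpos).2 (hD x κ)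
      exact B8Thm4ExistsLocal.bond_1110_local hη U₀ U₁ v (logCfg η U₁) κ hLc hα₄ ht hηt (hvlam x) (hvlam (x + e κ)) hexp
        (hlam x) hD' hAb' hs₁ hs₂
    have hsa : ∀ (x : Site d) (κ : Fin d), IsSelfAdjoint (logCfg η W x κ) := by
      intro x κ
      obtain ⟨-, -, hsa, -⟩ := B8Thm4TruncationLocal.base_datum hη U₀ W hWu (le_refl (1 / 4 : ℝ)) x κ (hbond x κ).2.2
      exact hsa
    -- the Landau letter, and the reset `2Lc⋆ + 8α₄ ↦ c⋆` by Proposition 3 (first member)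
    have hLanT : LanT L P η G U₀ U' (m + 1) W := ⟨hLan, u, huG, huP, hW, h129⟩
    have hreset := hP3 (m + 1) (by omega) (by omega) u W (logCfg η W) huu hW h129 hLanT
      (fun j hj b _ => ⟨(hbond b.1 b.2).2.1.symm, (hbond b.1 b.2).1.trans (bound_anti_level₁ hL1 hη hg0 hj)⟩)
    exact ⟨u, W, huG, huP, h129, hW, fun _ => hLan, fun x κ =>
      ⟨(hbond x κ).2.1.symm, hsa x κ, hreset (m + 1) le_rfl (x, κ) (sideTouches_univ hd2 x κ)⟩⟩
  -- THE BASE DATUM: `u = 1`, `W = U′`, `A₀ = (1/iη) log U′`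
  have hone : mgauge U₀ (1 : Site d → 𝔸ˣ) U' = U' := by
    funext z μ; simp [mgauge_apply]
  have base : ∀ (x : Site d) (κ : Fin d), U' x κ = cfgExp η (logCfg η U') x κ ∧ IsSelfAdjoint (logCfg η U' x κ) ∧
      ‖logCfg η U' x κ‖ ≤ cstar * ((L : ℝ) ^ 0 * η)⁻¹ := by
    intro x κ
    obtain ⟨-, hexp, hsa, hbd⟩ := B8Thm4TruncationLocal.base_datum hη U₀ U' hU'u ha x κ (h66 x κ)
    refine ⟨hexp, hsa, hbd.trans ?_⟩
    rw [pow_zero, one_mul]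
    exact mul_le_mul_of_nonneg_right ha2 (inv_nonneg.mpr hη.le)
  intro m
  induction m with
  | zero =>
    intro _
    exact ⟨1, U', fun x => G.one_mem, fun x i => rfl, B8Thm4TruncationLocal.restr129_one L 0 (torusLam 0) U₀, hone,
      fun h => absurd h (by omega), base⟩
  | succ m ih =>
    intro hmk
    rcases Nat.eq_zero_or_pos m with rfl | hm
    · -- the first step («k = 1»): Proposition 5 for the base datum
      obtain ⟨v, lam, hvG, hvP, hvlam, hlam, hD, hLan, h129⟩ := hP5base
      exact tail 0 (by omega) 1 U' (fun x => G.one_mem) (fun x i => rfl) hone base v lam hvG hvP hvlam hlam hD hLan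
        (by rw [one_mul]; exact h129)
    · -- the general step: Proposition 5 for the datum delivered at level `m`
      obtain ⟨u₁, U₁, hu₁G, hu₁P, h129₁, hU₁, hLan₁, hA⟩ := ih (by omega)
      obtain ⟨v, lam, hvG, hvP, hvlam, hlam, hD, hLan, h129⟩ :=
        hP5 m hm (by omega) u₁ U₁ (logCfg η U₁) hu₁G hu₁P hU₁ h129₁ (hLan₁ hm) hA
      exact tail m (by omega) u₁ U₁ hu₁G hu₁P hU₁ hA v lam hvG hvP hvlam hlam hD hLan h129

end Driver

/-! ## §6 Proposition 3 for the FINAL level-`k` gauge-fixed field of the torus induction, all members, pointwise (p. 88 «Of course this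
theorem implies Theorem 2. Proposition 3 implies …»; the `ℤᵈ` engine `B8Thm2GaugeFixedKLevel.thm2_norms_gaugeFixed_kLevel` by name) -/

section Final

variable {𝔸 : Type*} [CStarAlgebra 𝔸] [Nontrivial 𝔸]
variable {L k : ℕ} {P : ℤ} {η : ℝ} {G : Subgroup 𝔸ˣ} {U₀ U' : Site d → Fin d → 𝔸ˣ}

/-- **PROPOSITION 3 (p. 87, (1.62): «B₁ = 5dLB₀, B₂(β₀) = 5dLB₀(β₀)») FOR THE FINAL LEVEL-`k` GAUGE-FIXED FIELD ON THE TORUS, ALL FIVE LINES,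
POINTWISE** at the top weight `(Lᵏη)ᵖ`: for `(u, W = U′^{u⁻¹}, A = (1/iη) log W)` with `u` `G`-valued `P`-periodic, (1.29) at `k` levels,
(1.38), `A` self-adjoint with `|A| ≤ c⋆(Lᵏη)⁻¹`: `Lines159 L k η β₀ (5dL(α₀ + α₁ᵉ)) (5dL(α₀ + α₁ᵉ)) len U₀ A` with `B₀`, `B₀(β₀)` absorbed — i.e.
`(Lᵏη)|A| , (Lᵏη)²|∇^η_{U₀}A|, (Lᵏη)³|D^{η*}_{U₀}D^η_{U₀}A|, (Lᵏη)³|Δ^η_{U₀}A| ≤ 5dLB₀(α₀ + α₁ᵉ)` and `(Lᵏη)^{2+β}‖A‖_{1,β} ≤ 5dLB₀(β₀)(α₀ +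
α₁ᵉ)` (`0 ≤ β ≤ β₀`, admissible pairs).  PROOF = `B8Thm2GaugeFixedKLevel.thm2_norms_gaugeFixed_kLevel` at `Ω_j = T_η`, `Lan := LanT`, once per
pointwise quantity through its abstract `Lp`∕`Hol` slots, its sockets `H42`∕`H59full` served by `Sock142`∕`Sock159` (guard `2Lc⋆ + 8α₄ ≥ c⋆`;
the weighted suprema by `B8ScaledSupNorm.msup_le` from the pointwise lines); its windows at `α₂ = c⋆` follow from those at `2Lc⋆ + 8α₄`.
HONEST SCOPE: Proposition 3 is not re-proved; (1.59), (1.42) are hypotheses; count-neutral.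
[cite: Balaban1985RegularSpaces, Prop. 3 (1.62) p.87, Thm 2 (1.36)–(1.39) pp.82–83, p.88] -/
theorem final_norms (hd2 : 2 ≤ d) (hη : 0 < η) (hL : 2 ≤ L) (hk : 1 ≤ k) (hG : G ≤ unitaryUnits 𝔸)
    (hU₀ : ∀ x κ, U₀ x κ ∈ G)
    {α₀ α₁e α₄ β₀ B₀ B₀β cstar : ℝ} {len : Site d → ℝ}
    (hα₀ : 0 < α₀) (hα₁e : 0 ≤ α₁e) (hα₄ : 0 ≤ α₄) (hB₀ : 0 ≤ B₀) (hB₀β : 0 ≤ B₀β)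
    (hc : cstar = 5 * d * L * B₀ * (α₀ + α₁e))
    (hα3 : C0 d * α₀ ≤ 1 / 3) (hα4 : 4 * α₀ ≤ c2' d L)
    (h16 : 16 * (2 * (L * cstar) + 8 * α₄) ≤ 1) (hd5 : 5 * (2 * (L * cstar) + 8 * α₄) * ((d : ℝ) - 1) ≤ 4)
    (hsmall : Real.exp (4 * (800 * ((d : ℝ) + 1) ^ 2 * ((d : ℝ) + 4)) * α₀)
      * (1 + 8 * (131072 * ((d : ℝ) + 1) ^ 2) * (2 * (L * cstar) + 8 * α₄)) ≤ 2)
    (hc₃ : 2 * (2 * (L * cstar) + 8 * α₄) ≤ c3 d L) (hside : 36 * d * B₀ * (2 * (L * cstar) + 8 * α₄) ≤ 1 / 2)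
    (h50 : 50 * d * (2 * (L * cstar) + 8 * α₄) ≤ 1)
    {C₂ : ℝ} (hC₂ : 8 * (131072 * ((d : ℝ) + 1) ^ 2) * Real.exp (4 * (800 * ((d : ℝ) + 1) ^ 2 * ((d : ℝ) + 4)) * α₀) ≤ C₂)
    (h61 : 2 * (2 * (L * cstar) + 8 * α₄) ^ 2 + 20 * d * α₀ * (2 * (L * cstar) + 8 * α₄)
      + 2 * C₂ * (2 * (L * cstar) + 8 * α₄) ^ 2 ≤ α₀ + α₁e)
    (h33 : InAk L k η α₀ (fun _ => (Set.univ : Set (Site d))) U₀)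
    (h34 : InAk L k η α₀ (fun _ => (Set.univ : Set (Site d))) (U' * U₀))
    (h42 : ∀ m, 1 ≤ m → m ≤ k → Sock142 L P η α₁e (2 * (L * cstar) + 8 * α₄) G U₀ U' m)
    (h59 : ∀ m, 1 ≤ m → m ≤ k → Sock159 L P η β₀ B₀ B₀β (2 * (L * cstar) + 8 * α₄) len G U₀ U' m)
    {u : Site d → 𝔸ˣ} {W : Site d → Fin d → 𝔸ˣ} (huG : ∀ x, u x ∈ G) (huP : ∀ (x : Site d) (i : Fin d), u (x + P • e i) = u x)
    (hW : mgauge U₀ u W = U') (h129 : Restr129 L k (torusLam k) U₀ u)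
    (hLan : IsLandau138W L k η (Set.univ : Set (Site d)) (torusLam k) U₀ W)
    (hA : ∀ (x : Site d) (κ : Fin d), W x κ = cfgExp η (logCfg η W) x κ ∧ IsSelfAdjoint (logCfg η W x κ) ∧
      ‖logCfg η W x κ‖ ≤ cstar * ((L : ℝ) ^ k * η)⁻¹) :
    (∀ (x : Site d) (μ κ : Fin d),
        ((L : ℝ) ^ k * η) ^ 2 * ‖covDerivFwd η U₀ μ (fun z => logCfg η W z κ) x‖ ≤ 5 * d * L * B₀ * (α₀ + α₁e)) ∧
      (∀ (x : Site d) (μ : Fin d),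
        ((L : ℝ) ^ k * η) ^ 3 * ‖pdiv η U₀ (plaqCovDeriv η U₀ (logCfg η W)) μ x‖ ≤ 5 * d * L * B₀ * (α₀ + α₁e)) ∧
      (∀ (x : Site d) (κ : Fin d),
        ((L : ℝ) ^ k * η) ^ 3 * ‖covLap η U₀ (fun z => logCfg η W z κ) x‖ ≤ 5 * d * L * B₀ * (α₀ + α₁e)) ∧
      (∀ β : ℝ, 0 ≤ β → β ≤ β₀ → ∀ (μ κ : Fin d) (q : Site d × Site d), q ∈ AdmPair η len →
        ((L : ℝ) ^ k * η) ^ (2 + β) * hquot η β len U₀ (covDerivFwd η U₀ μ (fun z => logCfg η W z κ)) q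
          ≤ 5 * d * L * B₀β * (α₀ + α₁e)) := by
  have hL1 : 1 ≤ L := le_trans (by norm_num) hL
  have hLr : (1 : ℝ) ≤ L := by exact_mod_cast hL1
  have hcstar : 0 ≤ cstar := by rw [hc]; positivity
  set g : ℝ := 2 * (L * cstar) + 8 * α₄ with hg_def
  have hg0 : 0 ≤ g := by positivity
  have hcg : cstar ≤ g := by rw [hg_def]; nlinarith
  have hU₀u : ∀ x κ, U₀ x κ ∈ unitaryUnits 𝔸 := fun x κ => hG (hU₀ x κ)
  have huu : ∀ x, u x ∈ unitaryUnits 𝔸 := fun x => hG (huG x)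
  -- the engine's windows at the guard `c⋆ ≤ 2Lc⋆ + 8α₄`
  have hC₂0 : 0 ≤ C₂ := le_trans (by positivity) hC₂
  have hd1 : (0 : ℝ) ≤ (d : ℝ) - 1 := by
    have : (2 : ℝ) ≤ d := by exact_mod_cast hd2
    linarith
  have h16' : 16 * cstar ≤ 1 := (mul_le_mul_of_nonneg_left hcg (by norm_num)).trans h16
  have hd5' : 5 * cstar * ((d : ℝ) - 1) ≤ 4 :=
    (mul_le_mul_of_nonneg_right (mul_le_mul_of_nonneg_left hcg (by norm_num)) hd1).trans hd5
  have hsmall' : Real.exp (4 * (800 * ((d : ℝ) + 1) ^ 2 * ((d : ℝ) + 4)) * α₀)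
      * (1 + 8 * (131072 * ((d : ℝ) + 1) ^ 2) * cstar) ≤ 2 := by
    refine le_trans (mul_le_mul_of_nonneg_left ?_ (Real.exp_pos _).le) hsmall
    have : 8 * (131072 * ((d : ℝ) + 1) ^ 2) * cstar ≤ 8 * (131072 * ((d : ℝ) + 1) ^ 2) * g :=
      mul_le_mul_of_nonneg_left hcg (by positivity)
    linarith
  have hc₃' : 2 * cstar ≤ c3 d L := by linarith
  have hside' : 36 * d * B₀ * cstar ≤ 1 / 2 := (mul_le_mul_of_nonneg_left hcg (by positivity)).trans hside
  have h50' : 50 * d * cstar ≤ 1 := (mul_le_mul_of_nonneg_left hcg (by positivity)).trans h50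
  have h61' : 2 * cstar ^ 2 + 20 * d * α₀ * cstar + 2 * C₂ * cstar ^ 2 ≤ α₀ + α₁e := by
    have hsq : cstar ^ 2 ≤ g ^ 2 := pow_le_pow_left₀ hcstar hcg 2
    have h1 : 20 * d * α₀ * cstar ≤ 20 * d * α₀ * g := mul_le_mul_of_nonneg_left hcg (by positivity)
    have h2 : 2 * C₂ * cstar ^ 2 ≤ 2 * C₂ * g ^ 2 := mul_le_mul_of_nonneg_left hsq (by positivity)
    linarith
  have h34' : InAk L k η α₀ (fun _ => (Set.univ : Set (Site d))) (mulCfg U' U₀) := h34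
  -- the guards of an engine datum `(u′, W′, A′)` at `c⋆`, weakened to the socket guard `g`
  have weak : ∀ {W' : Site d → Fin d → 𝔸ˣ} {A' : Site d → Fin d → 𝔸},
      (∀ j, j ≤ k → ∀ (y : Site d) (τ : Fin d), SideTouches (Set.univ : Set (Site d)) y τ →
        W' y τ = cfgExp η A' y τ ∧ ‖A' y τ‖ ≤ cstar * ((L : ℝ) ^ j * η)⁻¹) →
      ∀ j, j ≤ k → ∀ (y : Site d) (τ : Fin d), SideTouches (Set.univ : Set (Site d)) y τ →
        W' y τ = cfgExp η A' y τ ∧ ‖A' y τ‖ ≤ g * ((L : ℝ) ^ j * η)⁻¹ := by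
    intro W' A' h j hj y τ hs
    obtain ⟨h1, h2⟩ := h j hj y τ hs
    exact ⟨h1, h2.trans (mul_le_mul_of_nonneg_right hcg (inv_pos.mpr (B8ScaledSupNorm.scale_pos hL1 hη j)).le)⟩
  -- the five lines of the (1.59) socket for an engine datum, in the torus currency
  have sock : ∀ {W' : Site d → Fin d → 𝔸ˣ} {A' : Site d → Fin d → 𝔸}, LanT L P η G U₀ U' k W' →
      (∀ (y : Site d) (τ : Fin d), IsSelfAdjoint (A' y τ)) →
      (∀ j, j ≤ k → ∀ (y : Site d) (τ : Fin d), SideTouches (Set.univ : Set (Site d)) y τ →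
        W' y τ = cfgExp η A' y τ ∧ ‖A' y τ‖ ≤ cstar * ((L : ℝ) ^ j * η)⁻¹) →
      Lines159 L k η β₀ B₀ B₀β len U₀ A' := by
    intro W' A' hLan' hsa' hWA'
    obtain ⟨h138, u'', hu''G, hu''P, hu''W, hu''R⟩ := hLan'
    exact h59 k hk le_rfl u'' W' A' hu''G hu''P hu''W hu''R h138 hsa'
      (fun y τ => (hWA' k le_rfl y τ (sideTouches_univ hd2 y τ)).1)
      (fun y τ => (weak hWA' k le_rfl y τ (sideTouches_univ hd2 y τ)).2)
  -- our datum in the engine's currency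
  have hLanT : LanT L P η G U₀ U' k W := ⟨hLan, u, huG, huP, hW, h129⟩
  have hsa : ∀ (y : Site d) (τ : Fin d), IsSelfAdjoint (logCfg η W y τ) := fun y τ => (hA y τ).2.1
  have hA41 : ∀ j, j ≤ k → ∀ (y : Site d) (τ : Fin d), SideTouches ((fun _ => (Set.univ : Set (Site d))) j) y τ →
      W y τ = cfgExp η (logCfg η W) y τ ∧ ‖logCfg η W y τ‖ ≤ cstar * ((L : ℝ) ^ j * η)⁻¹ :=
    fun j hj y τ _ => ⟨(hA y τ).1, (hA y τ).2.2.trans (bound_anti_level₁ hL1 hη hcstar hj)⟩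
  have hA0 : ∀ (y : Site d) (τ : Fin d), (∀ j, j ≤ k → ¬ SideTouches ((fun _ => (Set.univ : Set (Site d))) j) y τ) →
      logCfg η W y τ = 0 := fun y τ h => absurd (sideTouches_univ hd2 y τ) (h 0 (Nat.zero_le _))
  -- THE ENGINE, once per pointwise quantity through the abstract `Lp` ∕ `Hol` slots
  have key : ∀ (Lp Hol : (Site d → Fin d → 𝔸) → ℝ),
      (∀ (W' : Site d → Fin d → 𝔸ˣ) (A' : Site d → Fin d → 𝔸), LanT L P η G U₀ U' k W' →
        (∀ (y : Site d) (τ : Fin d), IsSelfAdjoint (A' y τ)) →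
        (∀ j, j ≤ k → ∀ (y : Site d) (τ : Fin d), SideTouches (Set.univ : Set (Site d)) y τ →
          W' y τ = cfgExp η A' y τ ∧ ‖A' y τ‖ ≤ cstar * ((L : ℝ) ^ j * η)⁻¹) →
        Lp A' ≤ B₀ * rhs159 L k η U₀ A' ∧ Hol A' ≤ B₀β * rhs159 L k η U₀ A') →
      Lp (logCfg η W) ≤ 5 * d * L * B₀ * (α₀ + α₁e) ∧ Hol (logCfg η W) ≤ 5 * d * L * B₀β * (α₀ + α₁e) := by
    intro Lp Hol hLH
    obtain ⟨-, -, -, hl, hh⟩ := B8Thm2GaugeFixedKLevel.thm2_norms_gaugeFixed_kLevel hd2 hη hL k hU₀u hα₀ hα₁e hB₀ hB₀β hc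
      hα3 hα4 h16' hd5' hsmall' hc₃' hside' h50' hC₂ h61' (fun _ => (Set.univ : Set (Site d))) (fun m => torusLam m)
      (fun m j => bondsOn (torusLam m) j) (fun _ _ _ _ _ _ => Set.mem_univ _) h33 h34' (LanT L P η G U₀ U') Lp Hol
      (fun u' W' A' hu' hW' h129' hLan' hsa' hWA' hA0' =>
        h42_engine hd2 h42 k hk le_rfl u' W' A' hu' hW' h129' hLan' hsa' (weak hWA') hA0')
      (fun u' W' A' hu' hW' h129' hLan' hsa' hWA' hA0' => by
        obtain ⟨e1, e2⟩ := h59_engine hd2 hL1 hη hB₀ h59 k hk le_rfl u' W' A' hu' hW' h129' hLan' hsa' (weak hWA') hA0'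
        obtain ⟨-, -, l3, -, -⟩ := sock hLan' hsa' hWA'
        obtain ⟨l4, l5⟩ := hLH W' A' hLan' hsa' hWA'
        have hN : 0 ≤ B₀ * rhs159 L k η U₀ A' := mul_nonneg hB₀ (rhs159_nonneg L k hη.le U₀ A')
        refine ⟨e1, e2, ?_, l4, l5⟩
        refine B8ScaledSupNorm.msup_le hN fun j hj b _ => ?_
        have e3 : (-(3 : ℝ)) = -((3 : ℕ) : ℝ) := by norm_num
        rw [e3, B8ScaledSupNorm.weight_neg_natCast L η 3 j]
        exact (weight_mono_level hL1 hη hj 3 (norm_nonneg _)).trans (l3 b.1 b.2))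
      huu hW h129 hLanT hsa hA41 hA0
    exact ⟨hl, hh⟩
  have hN0 : ∀ A' : Site d → Fin d → 𝔸, (fun _ : (Site d → Fin d → 𝔸) => (0 : ℝ)) A' ≤ B₀β * rhs159 L k η U₀ A' :=
    fun A' => mul_nonneg hB₀β (rhs159_nonneg L k hη.le U₀ A')
  have hN0' : ∀ A' : Site d → Fin d → 𝔸, (fun _ : (Site d → Fin d → 𝔸) => (0 : ℝ)) A' ≤ B₀ * rhs159 L k η U₀ A' :=
    fun A' => mul_nonneg hB₀ (rhs159_nonneg L k hη.le U₀ A')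
  refine ⟨fun x μ κ => ?_, fun x μ => ?_, fun x κ => ?_, fun β hβ hββ₀ μ κ q hq => ?_⟩
  · exact (key (fun A => ((L : ℝ) ^ k * η) ^ 2 * ‖covDerivFwd η U₀ μ (fun z => A z κ) x‖) (fun _ => 0)
      (fun W' A' hLan' hsa' hWA' => ⟨(sock hLan' hsa' hWA').2.1 x μ κ, hN0 A'⟩)).1
  · exact (key (fun A => ((L : ℝ) ^ k * η) ^ 3 * ‖pdiv η U₀ (plaqCovDeriv η U₀ A) μ x‖) (fun _ => 0)
      (fun W' A' hLan' hsa' hWA' => ⟨(sock hLan' hsa' hWA').2.2.1 x μ, hN0 A'⟩)).1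
  · exact (key (fun A => ((L : ℝ) ^ k * η) ^ 3 * ‖covLap η U₀ (fun z => A z κ) x‖) (fun _ => 0)
      (fun W' A' hLan' hsa' hWA' => ⟨(sock hLan' hsa' hWA').2.2.2.1 x κ, hN0 A'⟩)).1
  · exact (key (fun _ => 0)
      (fun A => ((L : ℝ) ^ k * η) ^ (2 + β) * hquot η β len U₀ (covDerivFwd η U₀ μ (fun z => A z κ)) q)
      (fun W' A' hLan' hsa' hWA' => ⟨hN0' A', (sock hLan' hsa' hWA').2.2.2.2 β hβ hββ₀ μ κ q hq⟩)).2

end Final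

/-! ## §7 The uniqueness clause on the torus (p. 95 «To prove the uniqueness let us assume that there are two transformations u₁, u₂ …
thus u′ is a solution of the problem described in Proposition 5 … The uniqueness implies u′ = 1, or u₁ = u₂»), modulo Proposition 5's
uniqueness clause (1.109) — the all-torus run of `B8Thm4UniqueLocal.thm4_unique_local` with `G`-valued periodic gauges -/

section Unique

variable {𝔸 : Type*} [CStarAlgebra 𝔸] [Nontrivial 𝔸]
variable {L k : ℕ} {P : ℤ} {η : ℝ} {G : Subgroup 𝔸ˣ} {U₀ U' : Site d → Fin d → 𝔸ˣ}

omit [Nontrivial 𝔸] in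
/-- `U^{1} = U` for the moving-frame action (1.17). [cite: Balaban1985RegularSpaces, (1.17) p.78] -/
theorem mgauge_one_left' (V₀ W : Site d → Fin d → 𝔸ˣ) : mgauge V₀ 1 W = W := by
  funext x κ
  simp [mgauge_apply]

omit [Nontrivial 𝔸] in
/-- `(1/iη) log e^{iηA} = A` as configurations, for `|A| ≤ c(Lᵏη)⁻¹`, `16c ≤ 1` (`B8Prop3GaugeFixedKLevel.log_cfgExp_eq` bondwise): the Landau
letter of `W = e^{iηA}` is that of `A`. [cite: Balaban1985RegularSpaces, (1.36) p.82, (1.38) p.82] -/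
theorem logCfg_cfgExp_eq (hη : 0 < η) (hL1 : 1 ≤ L) (k : ℕ) {c : ℝ} (hc : 0 ≤ c) (hc16 : 16 * c ≤ 1) {A : Site d → Fin d → 𝔸}
    (hA : ∀ (x : Site d) (κ : Fin d), ‖A x κ‖ ≤ c * ((L : ℝ) ^ k * η)⁻¹) : logCfg η (cfgExp η A) = A := by
  have hLr : (1 : ℝ) ≤ L := by exact_mod_cast hL1
  funext x κ
  have hLj : (1 : ℝ) ≤ (L : ℝ) ^ k := one_le_pow₀ hLr
  have hA' : ‖A x κ‖ ≤ c * η⁻¹ := by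
    calc ‖A x κ‖ ≤ c * ((L : ℝ) ^ k * η)⁻¹ := hA x κ
      _ = c * η⁻¹ * ((L : ℝ) ^ k)⁻¹ := by rw [mul_inv]; ring
      _ ≤ c * η⁻¹ * 1 := by
          apply mul_le_mul_of_nonneg_left (inv_le_one_of_one_le₀ hLj) (by positivity)
      _ = c * η⁻¹ := mul_one _
  exact B8Prop3GaugeFixedKLevel.log_cfgExp_eq hη hA' (by linarith)

/-- **THEOREM 2's UNIQUENESS CLAUSE ON THE TORUS, MODULO PROPOSITION 5 (1.109)** («exactly one gauge transformation u», p. 83; proof p. 95).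
Data: `G ≤ U(𝔸)`, `G`-valued `U₀`, `U′` with (1.33)∕(1.34) `U₀, U′U₀ ∈ 𝔄_k({T_η}, α₀)`, `U′U₀ ∈ Ax_k(𝔅_k, U₀)`; two `G`-valued `P`-periodic
`u₁, u₂` with (1.29) at `k` levels such that `U_i := U′^{u_i⁻¹} = e^{iηA_i}` with `A_i` self-adjoint, (1.36)₁ at the top level `|A_i| ≤
c_A(Lᵏη)⁻¹`, and (1.38) `IsLandau138 … A_i`; the windows of `B8Thm4UniqueLocal` for `c = c_A` («for α₀ + α₁ sufficiently small») and
the thresholds `2α₃′ < c_u`, `5c_A < c_u` of the domain (1.109).  CONCLUSION: `u₁ = u₂` (literally, on `ℤᵈ`: the level-`k` towers cover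
`ℤᵈ`).  PROOF = the printed paragraph: `u′ = u₁⁻¹u₂` is `G`-valued periodic, `= e^{iλ′}` with `λ′` `𝔤`-valued in the domain at every site
(`B8Thm4UniqueLocal.lam_in_domain_local` on the tower of each site) and at EVERY bond (`B8Ineq1109Local.ineq1109_scaled`, (1.84), the
smallness of `λ′` being known at both end-points); `U₁^{u′⁻¹} = U₂` is Landau and `u₁u′ = u₂` has (1.29); «a configuration identically
equal to 1 is a solution also»; the socket `SockP5Uniq` gives `u′ = 1`. [cite: Balaban1985RegularSpaces, Thm 2 p.83, p.95 (1.112), Prop. 5 (1.107)–(1.109) p.94] -/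
theorem torus_unique (hd : 1 ≤ d) (hη : 0 < η) (hL : 2 ≤ L) (hG : G ≤ unitaryUnits 𝔸)
    (hU₀ : ∀ x κ, U₀ x κ ∈ G) (hU' : ∀ x κ, U' x κ ∈ G)
    {α₀ cA cu : ℝ} (hα₀ : 0 < α₀) (hα3 : C0 d * α₀ ≤ 1 / 3) (hα4 : 4 * α₀ ≤ c2' d L) (hcA : 0 ≤ cA)
    (hsmall : Real.exp (4 * (800 * ((d : ℝ) + 1) ^ 2 * ((d : ℝ) + 4)) * α₀) * (1 + 8 * (131072 * ((d : ℝ) + 1) ^ 2) * cA) ≤ 2)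
    (hc₃ : 2 * cA ≤ c3 d L) (hsm : 2048 * (d : ℝ) * cA ≤ 1) (hα₃ : 40 * d * cA ≤ 1 / 5000)
    (hcu₁ : 2 * (2 * (40 * d * cA) + 2 * 1116 * (40 * d * cA) ^ 2) < cu) (hcu₂ : 5 * cA < cu)
    (h33 : InAk L k η α₀ (fun _ => (Set.univ : Set (Site d))) U₀)
    (h34 : InAk L k η α₀ (fun _ => (Set.univ : Set (Site d))) (U' * U₀)) (hAx : InAx L k (torusLam k) U₀ (U' * U₀))
    (hU : SockP5Uniq L k P η cA cu G U₀ U')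
    {u₁ u₂ : Site d → 𝔸ˣ} {A₁ A₂ : Site d → Fin d → 𝔸}
    (hu₁G : ∀ x, u₁ x ∈ G) (hu₁P : ∀ (x : Site d) (i : Fin d), u₁ (x + P • e i) = u₁ x)
    (hu₂G : ∀ x, u₂ x ∈ G) (hu₂P : ∀ (x : Site d) (i : Fin d), u₂ (x + P • e i) = u₂ x)
    (h129₁ : Restr129 L k (torusLam k) U₀ u₁) (h129₂ : Restr129 L k (torusLam k) U₀ u₂)
    (h₁ : mgauge U₀ u₁ (cfgExp η A₁) = U') (h₂ : mgauge U₀ u₂ (cfgExp η A₂) = U')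
    (hsa₁ : ∀ (x : Site d) (κ : Fin d), IsSelfAdjoint (A₁ x κ))
    (h62₁ : ∀ (x : Site d) (κ : Fin d), ‖A₁ x κ‖ ≤ cA * ((L : ℝ) ^ k * η)⁻¹)
    (h62₂ : ∀ (x : Site d) (κ : Fin d), ‖A₂ x κ‖ ≤ cA * ((L : ℝ) ^ k * η)⁻¹)
    (hLan₁ : IsLandau138 L k η (Set.univ : Set (Site d)) (torusLam k) U₀ A₁)
    (hLan₂ : IsLandau138 L k η (Set.univ : Set (Site d)) (torusLam k) U₀ A₂) : u₁ = u₂ := by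
  have hL1 : 1 ≤ L := le_trans (by norm_num) hL
  have hLr : (1 : ℝ) ≤ L := by exact_mod_cast hL1
  have hd' : (1 : ℝ) ≤ d := by exact_mod_cast hd
  have hα2 : 2 * α₀ ≤ c2' d L := by linarith
  have hU₀u : ∀ x κ, U₀ x κ ∈ unitaryUnits 𝔸 := fun x κ => hG (hU₀ x κ)
  have hU'u : ∀ x κ, U' x κ ∈ unitaryUnits 𝔸 := fun x κ => hG (hU' x κ)
  have hu₁u : ∀ x, u₁ x ∈ unitaryUnits 𝔸 := fun x => hG (hu₁G x)
  have hu₂u : ∀ x, u₂ x ∈ unitaryUnits 𝔸 := fun x => hG (hu₂G x)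
  -- the level-`k` towers cover `ℤᵈ`; (1.33)/(1.34) on each tower
  have htow : ∀ x : Site d, InBox (tlo L (flm L k x) k) (thi L (flm L k x) k) x := inBox_tower_flm hL1 k
  have hy : ∀ y : Site d, y ∈ torusLam (d := d) k k := fun y => by rw [torusLam_self]; exact Set.mem_univ _
  have h33t : ∀ y : Site d, pdevOn (tlo L y k) (thi L y k) U₀ < α₀ * (((L : ℝ) ^ k)⁻¹) ^ 2 :=
    fun y => B8Prop6OfThm4.pdevOn_lt_of_inAk_top hL1 hα₀ h33 fun _ _ => Set.mem_univ _
  have h34t : ∀ y : Site d, pdevOn (tlo L y k) (thi L y k) (U' * U₀) < α₀ * (((L : ℝ) ^ k)⁻¹) ^ 2 :=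
    fun y => B8Prop6OfThm4.pdevOn_lt_of_inAk_top hL1 hα₀ h34 fun _ _ => Set.mem_univ _
  -- `λ′ := (1/i) log u′`, `u′ = u₁⁻¹u₂`, in the domain (1.109) at every site (on its own tower) …
  set a₃ : ℝ := 2 * (40 * d * cA) + 2 * 1116 * (40 * d * cA) ^ 2 with ha₃
  set lam : Site d → 𝔸 := fun z => (I⁻¹ : ℂ) • mlog ((((u₁⁻¹ * u₂) z : 𝔸ˣ)) : 𝔸) with hlam
  have hsite : ∀ x : Site d, ((gaugeExp lam x : 𝔸ˣ) : 𝔸) = (((u₁⁻¹ * u₂) x : 𝔸ˣ) : 𝔸) ∧ IsSelfAdjoint (lam x) ∧ ‖lam x‖ ≤ 2 * a₃ := by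
    intro x
    obtain ⟨he, hsa, hn, -⟩ := B8Thm4UniqueLocal.lam_in_domain_local hd hL hL1 hη hU₀u hU'u hu₁u hu₂u hα₀ hα3 hα4 hcA hsmall hc₃
      hsm hα₃ hα₀ hα3 hα2 hAx h129₁ h129₂ h₁ h₂ le_rfl (hy (flm L k x)) (h33t _) (h34t _)
      (fun z κ _ _ => h62₁ z κ) (fun z κ _ _ => h62₂ z κ) x (htow x)
    exact ⟨he, hsa, hn⟩
  -- … and at EVERY bond ((1.84): `U₁^{u′⁻¹} = U₂` read bondwise, smallness of `λ′` at both end-points)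
  have ha₃0 : 0 ≤ 40 * d * cA := by positivity
  have ha₃le : a₃ ≤ 1 / 2000 := by rw [ha₃]; nlinarith
  have hs : 2 * a₃ ≤ 1 / 1000 := by linarith
  have hc170 : cA * ((L : ℝ) ^ k)⁻¹ ≤ 1 / 170 := by
    have hLj : (1 : ℝ) ≤ (L : ℝ) ^ k := one_le_pow₀ hLr
    have hinv : ((L : ℝ) ^ k)⁻¹ ≤ 1 := inv_le_one_of_one_le₀ hLj
    have hc' : cA ≤ 1 / 170 := by nlinarith
    calc cA * ((L : ℝ) ^ k)⁻¹ ≤ cA * 1 := mul_le_mul_of_nonneg_left hinv hcA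
      _ ≤ 1 / 170 := by linarith
  have hq : mgauge U₀ (u₁⁻¹ * u₂)⁻¹ (cfgExp η A₁) = cfgExp η A₂ := B8Ineq1109Local.mgauge_quotient_eq U₀ u₁ u₂ _ _ U' h₁ h₂
  have hbond : ∀ (x : Site d) (κ : Fin d), ((L : ℝ) ^ k * η) * ‖covDerivFwd η U₀ κ lam x‖ ≤ 5 * cA := by
    intro x κ
    obtain ⟨hex, -, hnx⟩ := hsite x
    obtain ⟨hexe, -, hnxe⟩ := hsite (x + e κ)
    have hux : gaugeExp lam x = (u₁⁻¹ * u₂) x := Units.ext hex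
    have huxe : gaugeExp lam (x + e κ) = (u₁⁻¹ * u₂) (x + e κ) := Units.ext hexe
    have hU₁₂ : mgauge U₀ (fun z => (gaugeExp lam z)⁻¹) (cfgExp η A₁) x κ = cfgExp η A₂ x κ := by
      rw [← hq, mgauge_apply, mgauge_apply, hux, huxe, Pi.inv_apply, Pi.inv_apply]
    exact B8Ineq1109Local.ineq1109_scaled hη U₀ A₁ A₂ κ (unitaryUnits_le_U1 (hU₀u x κ)) hL1 hs hnx hnxe (h62₁ x κ) (h62₂ x κ)
      hc170 hU₁₂
  have hcu : 0 < cu := lt_of_le_of_lt (by positivity) hcu₂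
  have hdom : ∀ x : Site d, ((gaugeExp lam x : 𝔸ˣ) : 𝔸) = (((u₁⁻¹ * u₂) x : 𝔸ˣ) : 𝔸) ∧ IsSelfAdjoint (lam x) ∧ ‖lam x‖ < cu ∧
      ∀ κ : Fin d, ((L : ℝ) ^ k * η) * ‖covDerivFwd η U₀ κ lam x‖ < cu := by
    intro x
    obtain ⟨he, hsa, hn⟩ := hsite x
    exact ⟨he, hsa, lt_of_le_of_lt hn hcu₁, fun κ => lt_of_le_of_lt (hbond x κ) hcu₂⟩
  -- «a configuration identically equal to 1 is a solution also»: `1 = e^{i0}`, `0` in the domain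
  have hdom1 : ∀ x : Site d, ((gaugeExp (fun _ => (0 : 𝔸)) x : 𝔸ˣ) : 𝔸) = (((1 : Site d → 𝔸ˣ) x : 𝔸ˣ) : 𝔸) ∧
      IsSelfAdjoint ((fun _ => (0 : 𝔸)) x) ∧ ‖(fun _ => (0 : 𝔸)) x‖ < cu ∧
      ∀ κ : Fin d, ((L : ℝ) ^ k * η) * ‖covDerivFwd η U₀ κ (fun _ => (0 : 𝔸)) x‖ < cu := by
    intro x
    refine ⟨?_, IsSelfAdjoint.zero 𝔸, by simpa using hcu, fun κ => ?_⟩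
    · rw [gaugeExp, smul_zero, B7Prop8Flat.expUnit_zero, Pi.one_apply]
    · have h0 : covDerivFwd η U₀ κ (fun _ => (0 : 𝔸)) x = 0 := by
        rw [covDerivFwd, B7Eq78Linearization.conjR_apply, mul_zero, zero_mul, sub_zero, smul_zero]
      rw [h0, norm_zero, mul_zero]
      exact hcu
  -- `u′` is `G`-valued and periodic; so is `1`
  have hvG : ∀ x, (u₁⁻¹ * u₂) x ∈ G := fun x => by
    rw [Pi.mul_apply, Pi.inv_apply]; exact G.mul_mem (G.inv_mem (hu₁G x)) (hu₂G x)
  have hvP : ∀ (x : Site d) (i : Fin d), (u₁⁻¹ * u₂) (x + P • e i) = (u₁⁻¹ * u₂) x := by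
    intro x i; simp only [Pi.mul_apply, Pi.inv_apply, hu₁P, hu₂P]
  have h1G : ∀ x, (1 : Site d → 𝔸ˣ) x ∈ G := fun _ => G.one_mem
  have h1P : ∀ (x : Site d) (i : Fin d), (1 : Site d → 𝔸ˣ) (x + P • e i) = (1 : Site d → 𝔸ˣ) x := fun _ _ => rfl
  -- the Landau letters: `U₁^{u′⁻¹} = U₂` and `U₁^{1⁻¹} = U₁`
  have hcA16 : 16 * cA ≤ 1 := by nlinarith
  have hlog₁ : logCfg η (cfgExp η A₁) = A₁ := logCfg_cfgExp_eq hη hL1 k hcA hcA16 h62₁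
  have hlog₂ : logCfg η (cfgExp η A₂) = A₂ := logCfg_cfgExp_eq hη hL1 k hcA hcA16 h62₂
  have hLanv : IsLandau138W L k η (Set.univ : Set (Site d)) (torusLam k) U₀ (mgauge U₀ (u₁⁻¹ * u₂)⁻¹ (cfgExp η A₁)) := by
    rw [hq]; unfold IsLandau138W; rw [hlog₂]; exact hLan₂
  have hLan1 : IsLandau138W L k η (Set.univ : Set (Site d)) (torusLam k) U₀ (mgauge U₀ (1 : Site d → 𝔸ˣ)⁻¹ (cfgExp η A₁)) := by
    rw [inv_one, mgauge_one_left']; unfold IsLandau138W; rw [hlog₁]; exact hLan₁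
  have h129v : Restr129 L k (torusLam k) U₀ (u₁ * (u₁⁻¹ * u₂)) := by rw [mul_inv_cancel_left]; exact h129₂
  have h1291 : Restr129 L k (torusLam k) U₀ (u₁ * 1) := by rw [mul_one]; exact h129₁
  -- Proposition 5's uniqueness: `u′ = 1`
  have huniq := hU u₁ A₁ hu₁G hu₁P h129₁ h₁ hsa₁ h62₁ hLan₁ (u₁⁻¹ * u₂) 1 lam (fun _ => 0) hvG hvP h1G h1P hdom hdom1
    hLanv h129v hLan1 h1291
  exact (inv_mul_eq_one.mp huniq)

end Unique

/-! ## §8 THEOREM 2 ON THE TORUS: the interface `B8Thm2TorusAt.Thm2TorusAt … G (fun _ => True)` from the sockets -/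

section Constants

/-- Print's renamed `α₁` of (1.66): «Thus the conditions (1.33)–(1.35) imply |Ũ′ʲ − 1| < 11d²α₀ + α₁ … For simplicity let us write α₁
instead of the right-hand side above» (p. 87). [cite: Balaban1985RegularSpaces, (1.65)–(1.66) p.87] -/
def alpha1e (d : ℕ) (α₀ α₁ : ℝ) : ℝ := 11 * (d : ℝ) ^ 2 * α₀ + α₁

/-- `c⋆ = B₁(α₀ + α₁) = 5dLB₀(α₀ + α₁)` of (1.62)∕(1.69) with the renamed `α₁` (Prop. 3: «B₁ = 5dLB₀», p. 87).
[cite: Balaban1985RegularSpaces, Prop. 3 (1.62) p.87, (1.69) p.88] -/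
def cstarT (d L : ℕ) (B₀ α₀ α₁ : ℝ) : ℝ := 5 * d * L * B₀ * (α₀ + alpha1e d α₀ α₁)

/-- `α₄ = 8B′₀B₁(α₀ + α₁)` of (1.108), written `B₄(α₀ + α₁)` with the renamed `α₁` (`B₄` = Proposition 5's constant `8B′₀B₁`).
[cite: Balaban1985RegularSpaces, (1.108) p.94] -/
def alpha4T (d : ℕ) (B₄ α₀ α₁ : ℝ) : ℝ := B₄ * (α₀ + alpha1e d α₀ α₁)

/-- The guard `2Lc⋆ + 8α₄` of (1.110)–(1.111) (the constant of (1.69) one level up, before Proposition 3's reset).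
[cite: Balaban1985RegularSpaces, (1.110)–(1.111) p.95] -/
def guardT (d L : ℕ) (B₀ B₄ α₀ α₁ : ℝ) : ℝ := 2 * (L * cstarT d L B₀ α₀ α₁) + 8 * alpha4T d B₄ α₀ α₁

/-- The constant `C₂` of (1.56)∕(1.61) in the `ℤᵈ` engines' explicit form ([3] Prop. 4 through `B8Prop3KLevel`).
[cite: Balaban1985RegularSpaces, (1.56) p.86, (1.61) p.87] -/
def C2T (d : ℕ) (α₀ : ℝ) : ℝ :=
  8 * (131072 * ((d : ℝ) + 1) ^ 2) * Real.exp (4 * (800 * ((d : ℝ) + 1) ^ 2 * ((d : ℝ) + 4)) * α₀)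

/-- **THE SMALLNESS WINDOWS** of Theorem 2 on the torus at one pair `(α₀, α₁)` — print's «for α₀ + α₁ sufficiently small» ∕ «with α₀ + α₁ ≦ c₁»
(pp. 83, 88, 95) and «at least for B₁ not too small» (p. 89), made explicit as the windows of the `ℤᵈ` engines this file runs BY NAME: the
Proposition-1∕2 regime of [3] for `α₀` (`c0`, `c2`), the window of (1.65) (`a6`), the base smallness of the induction (`a2` — this is «B₁ not
too small»: `2(11d²α₀ + α₁) ≤ c⋆`), (1.108)'s `α₄ ≤ 1/84` and `Lc⋆ ≤ 1/12` of (1.110), the windows of `B8Prop3KLevel.prop3_norms_kLevel` at the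
guard `2Lc⋆ + 8α₄` (`g16`–`g61`, `g61` being (1.61)), and the windows of `B8Thm4UniqueLocal` for the uniqueness paragraph with `c = B₁(α₀ + α₁)`
and the radius `c_u` of (1.109) (`uexp`–`ucu₂`).  Explicit and merely sufficient; all hold for `α₀ + α₁` small once `5dLB₀ ≥ 2`
(constants depending on `d`, `L` and the socket constants only). [cite: Balaban1985RegularSpaces, Thm 2 p.83 («α₀ + α₁ ≦ c₁»), p.89 («at least for B₁ not too small»), (1.61) p.87, (1.108)–(1.109) p.94] -/
structure Thm2TorusWindows (d L : ℕ) (B₀ B₄ cu B₁ α₀ α₁ : ℝ) : Prop where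
  c0 : C0 d * α₀ ≤ 1 / 3
  c2 : 4 * α₀ ≤ c2' d L
  a6 : alpha1e d α₀ α₁ ≤ 1 / 6
  a2 : 2 * alpha1e d α₀ α₁ ≤ cstarT d L B₀ α₀ α₁
  a84 : alpha4T d B₄ α₀ α₁ ≤ 1 / 84
  c12 : L * cstarT d L B₀ α₀ α₁ ≤ 1 / 12
  g16 : 16 * guardT d L B₀ B₄ α₀ α₁ ≤ 1
  gd5 : 5 * guardT d L B₀ B₄ α₀ α₁ * ((d : ℝ) - 1) ≤ 4
  gexp : Real.exp (4 * (800 * ((d : ℝ) + 1) ^ 2 * ((d : ℝ) + 4)) * α₀)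
    * (1 + 8 * (131072 * ((d : ℝ) + 1) ^ 2) * guardT d L B₀ B₄ α₀ α₁) ≤ 2
  gc3 : 2 * guardT d L B₀ B₄ α₀ α₁ ≤ c3 d L
  g36 : 36 * d * B₀ * guardT d L B₀ B₄ α₀ α₁ ≤ 1 / 2
  g50 : 50 * d * guardT d L B₀ B₄ α₀ α₁ ≤ 1
  g61 : 2 * guardT d L B₀ B₄ α₀ α₁ ^ 2 + 20 * d * α₀ * guardT d L B₀ B₄ α₀ α₁
    + 2 * C2T d α₀ * guardT d L B₀ B₄ α₀ α₁ ^ 2 ≤ α₀ + alpha1e d α₀ α₁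
  uexp : Real.exp (4 * (800 * ((d : ℝ) + 1) ^ 2 * ((d : ℝ) + 4)) * α₀)
    * (1 + 8 * (131072 * ((d : ℝ) + 1) ^ 2) * (B₁ * (α₀ + α₁))) ≤ 2
  uc3 : 2 * (B₁ * (α₀ + α₁)) ≤ c3 d L
  u2048 : 2048 * (d : ℝ) * (B₁ * (α₀ + α₁)) ≤ 1
  u40 : 40 * d * (B₁ * (α₀ + α₁)) ≤ 1 / 5000
  ucu₁ : 2 * (2 * (40 * d * (B₁ * (α₀ + α₁))) + 2 * 1116 * (40 * d * (B₁ * (α₀ + α₁))) ^ 2) < cu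
  ucu₂ : 5 * (B₁ * (α₀ + α₁)) < cu

end Constants

section SocketBundle

variable {𝔸 : Type*} [NormedRing 𝔸] [StarRing 𝔸] [NormedAlgebra ℂ 𝔸] [CompleteSpace 𝔸]

/-- **THE SOCKETS OF THEOREM 2 ON THE TORUS AT ONE PAIR `U₀, U′` AND ONE `(α₀, α₁)`** — everything print's proof of Theorem 2 takes from
outside pp. 82–89, 94–95: Proposition 5's existence at the first step and at every step `m ↦ m + 1 ≤ k` (Sects. C–E), the (1.42) clause
(constant `11d²α₀ + α₁` from (1.66) at the levels `m < k`, `α₁` from (1.35) at the top level `k`) and the in-edge (1.59) (Theorem 3.3 of [4]) for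
the gauge-fixed fields at every level `1 ≤ m ≤ k` (guard `2Lc⋆ + 8α₄`), and Proposition 5's uniqueness (1.109) for level-`k` solution data
(constant `B₁(α₀ + α₁)` of (1.36)₁, radius `c_u`).  Hypothesis shape, asserted for nothing.
[cite: Balaban1985RegularSpaces, Prop. 5 p.94, (1.42) p.83, (1.59) p.86, Thm 2 p.83] -/
def Thm2TorusSockets (L k : ℕ) (P : ℤ) (η β₀ B₀ B₀β B₄ cu B₁ : ℝ) (len : Site d → ℝ) (G : Subgroup 𝔸ˣ) (α₀ α₁ : ℝ)
    (U₀ U' : Site d → Fin d → 𝔸ˣ) : Prop :=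
  SockP5Base L P η (alpha4T d B₄ α₀ α₁) G U₀ U' ∧
    (∀ m, 1 ≤ m → m < k → SockP5Step L P η (cstarT d L B₀ α₀ α₁) (alpha4T d B₄ α₀ α₁) G U₀ U' m) ∧
    (∀ m, 1 ≤ m → m < k → Sock142 L P η (alpha1e d α₀ α₁) (guardT d L B₀ B₄ α₀ α₁) G U₀ U' m) ∧
    Sock142 L P η α₁ (guardT d L B₀ B₄ α₀ α₁) G U₀ U' k ∧
    (∀ m, 1 ≤ m → m ≤ k → Sock159 L P η β₀ B₀ B₀β (guardT d L B₀ B₄ α₀ α₁) len G U₀ U' m) ∧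
    SockP5Uniq L k P η (B₁ * (α₀ + α₁)) cu G U₀ U'

end SocketBundle

section Assembly

variable {𝔸 : Type*} [CStarAlgebra 𝔸] [Nontrivial 𝔸]
variable {L k : ℕ} {P : ℤ} {η : ℝ} {G : Subgroup 𝔸ˣ} {U₀ U' : Site d → Fin d → 𝔸ˣ}

omit [Nontrivial 𝔸] in
/-- `wᵖ·X ≤ R` ⇒ `X ≤ R·(w⁻¹)ᵖ` (`w > 0`): reading a weighted-norm bound pointwise. [cite: Balaban1985RegularSpaces, p.86 (definition after (1.55))] -/
theorem le_mul_inv_pow_of_pow_mul_le {w X R : ℝ} (hw : 0 < w) (p : ℕ) (h : w ^ p * X ≤ R) : X ≤ R * (w⁻¹) ^ p := by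
  rw [inv_pow, ← div_eq_mul_inv, le_div_iff₀ (pow_pos hw p)]
  linarith [mul_comm (w ^ p) X]

omit [Nontrivial 𝔸] in
/-- `wʳ·X ≤ R` ⇒ `X ≤ R·(w⁻¹)ʳ` (`w > 0`, real exponent — the Hölder weight `(Lʲη)^{2+β}`). [cite: Balaban1985RegularSpaces, (1.36) p.82] -/
theorem le_mul_inv_rpow_of_rpow_mul_le {w X R : ℝ} (hw : 0 < w) (r : ℝ) (h : w ^ r * X ≤ R) : X ≤ R * (w⁻¹) ^ r := by
  rw [Real.inv_rpow hw.le, ← div_eq_mul_inv, le_div_iff₀ (Real.rpow_pos_of_pos hw r)]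
  linarith [mul_comm (w ^ r) X]

/-- **THEOREM 2 ([Balaban1985RegularSpaces] p. 83) ON THE TORUS `Ω_j = T_η` AT ONE PAIR, FROM THE SOCKETS** — existence AND uniqueness, with
the conclusion (1.36)–(1.39) in the letters of record `B8Thm2TorusAt.Concl2T` (all three members of (1.36) incl. the Hölder member for `0 ≤ β ≤ β₀`,
(1.37), (1.38) in multiplier form, both members of (1.39)): for a gauge group `G ≤ U(𝔸)`, `G`-valued `P`-periodic `U₀`, `U′` with (1.33)–(1.35)
(`InAk`, `InAx L k (torusLam k)`, `Hyp135 L k (torusLam k)`; the rider «(3.35) of [4]» dropped, p. 82 «eventually we will drop it out of the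
assumptions»), the windows `Thm2TorusWindows` at `(α₀, α₁)` and output constants `B₁ > 5dLB₀(1 + 11d²)`, `B₂ > 5dLB₀(β₀)(1 + 11d²)` (Prop. 3's
`5dLB₀`, `5dLB₀(β₀)` at the renamed `α₁ = 11d²α₀ + α₁` of p. 87), GIVEN the sockets `Thm2TorusSockets`: there is exactly one `G`-valued
`P`-periodic `u` with (1.29) `Restr129 L k (torusLam k) U₀ u` and `Concl2T L k P η β₀ B₁ B₂ len α₀ α₁ U₀ U′ u`.  PROOF = print's (pp. 87–88,
95): (1.35) ⇒ (1.66)₀ (`norm_sub_one_le_torus`); Theorem 4's induction to level `k` (`torus_all_levels`); Proposition 3 for the final field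
(`final_norms`, the first member being the induction's own bound); the weights `(Lᵏη)ᵖ ≥ (Lʲη)ᵖ` give «on Ω_j, j = 0, …, k»; strict `<` from
`c⋆ < B₁(α₀ + α₁)`; uniqueness by `torus_unique`.  HONEST SCOPE: Theorem 2 is NOT proved outright — Proposition 5 (both halves), the in-edge
(1.59) and the (1.42) clause are hypotheses (sockets), exactly as in the `ℤᵈ` twin `B8Thm2GaugeFixedKLevel`; windows explicit; `T_η` read as
`P`-periodic data on `ℤᵈ`; count-neutral; nothing continuum ∕ ℝ⁴ ∕ OS ∕ mass-gap ∕ Clay. [cite: Balaban1985RegularSpaces, Thm 2 p.83, (1.33)–(1.39) pp.82–83, (1.65)–(1.66) p.87, Thm 4 p.88, Prop. 3 (1.62) p.87, p.95] -/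
theorem thm2_torus_pair (hd2 : 2 ≤ d) (hη : 0 < η) (hL : 2 ≤ L) (hk : 1 ≤ k) (hG : G ≤ unitaryUnits 𝔸)
    {β₀ B₀ B₀β B₄ cu B₁ B₂ : ℝ} {len : Site d → ℝ} (hB₀ : 0 ≤ B₀) (hB₀β : 0 ≤ B₀β) (hB₄ : 0 ≤ B₄)
    (hB₁ : 5 * d * L * B₀ * (1 + 11 * (d : ℝ) ^ 2) < B₁) (hB₂ : 5 * d * L * B₀β * (1 + 11 * (d : ℝ) ^ 2) < B₂)
    {α₀ α₁ : ℝ} (hα₀ : 0 < α₀) (hα₁ : 0 < α₁) (hw : Thm2TorusWindows d L B₀ B₄ cu B₁ α₀ α₁)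
    (hU₀ : ∀ x κ, U₀ x κ ∈ G) (hU' : ∀ x κ, U' x κ ∈ G)
    (hU₀P : ∀ i : Fin d, shiftCfg (P • e i) U₀ = U₀) (hU'P : ∀ i : Fin d, shiftCfg (P • e i) U' = U')
    (h33 : InAk L k η α₀ (fun _ => (Set.univ : Set (Site d))) U₀)
    (h34 : InAk L k η α₀ (fun _ => (Set.univ : Set (Site d))) (U' * U₀))
    (hAx : InAx L k (torusLam k) U₀ (U' * U₀)) (h35 : Hyp135 L k (torusLam k) α₁ U₀ U')
    (hS : Thm2TorusSockets L k P η β₀ B₀ B₀β B₄ cu B₁ len G α₀ α₁ U₀ U') :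
    ∃ u : Site d → 𝔸ˣ,
      ((∀ x, u x ∈ G) ∧ (∀ (x : Site d) (i : Fin d), u (x + P • e i) = u x) ∧ Restr129 L k (torusLam k) U₀ u ∧
          Concl2T L k P η β₀ B₁ B₂ len α₀ α₁ U₀ U' u) ∧
        ∀ u' : Site d → 𝔸ˣ, (∀ x, u' x ∈ G) → (∀ (x : Site d) (i : Fin d), u' (x + P • e i) = u' x) →
          Restr129 L k (torusLam k) U₀ u' → Concl2T L k P η β₀ B₁ B₂ len α₀ α₁ U₀ U' u' → u' = u := by
  have hL1 : 1 ≤ L := le_trans (by norm_num) hL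
  have hLr : (1 : ℝ) ≤ L := by exact_mod_cast hL1
  have hd1 : 1 ≤ d := le_trans (by norm_num) hd2
  have hd' : (1 : ℝ) ≤ d := by exact_mod_cast hd1
  obtain ⟨hP5b, hP5s, h42lt, h42k, h59, hUq⟩ := hS
  have hU₀u : ∀ x κ, U₀ x κ ∈ unitaryUnits 𝔸 := fun x κ => hG (hU₀ x κ)
  have hU'u : ∀ x κ, U' x κ ∈ unitaryUnits 𝔸 := fun x κ => hG (hU' x κ)
  have hU₀p : ∀ (x : Site d) (i : Fin d) (κ : Fin d), U₀ (x + P • e i) κ = U₀ x κ := apply_add_of_shiftCfg hU₀P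
  have hU'p : ∀ (x : Site d) (i : Fin d) (κ : Fin d), U' (x + P • e i) κ = U' x κ := apply_add_of_shiftCfg hU'P
  -- the constants
  set α₁e : ℝ := alpha1e d α₀ α₁ with hα₁e_def
  set cstar : ℝ := cstarT d L B₀ α₀ α₁ with hcstar_def
  set α₄ : ℝ := alpha4T d B₄ α₀ α₁ with hα₄_def
  have hα₁e0 : 0 ≤ α₁e := by rw [hα₁e_def, alpha1e]; positivity
  have hα₁le : α₁ ≤ α₁e := by rw [hα₁e_def, alpha1e]; nlinarith [sq_nonneg (d : ℝ), hα₀.le]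
  have hc : cstar = 5 * d * L * B₀ * (α₀ + α₁e) := rfl
  have hcstar0 : 0 ≤ cstar := by rw [hc]; positivity
  have hα₄0 : 0 ≤ α₄ := by rw [hα₄_def, alpha4T]; positivity
  have hg : guardT d L B₀ B₄ α₀ α₁ = 2 * (L * cstar) + 8 * α₄ := rfl
  -- the (1.42) clauses at all levels with the renamed constant `α₁ᵉ ≥ α₁`
  have h42 : ∀ m, 1 ≤ m → m ≤ k → Sock142 L P η α₁e (2 * (L * cstar) + 8 * α₄) G U₀ U' m := by
    intro m hm hmk
    rcases Nat.lt_or_ge m k with hlt | hge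
    · exact h42lt m hm hlt
    · obtain rfl : m = k := le_antisymm hmk hge
      exact sock142_mono hα₁le h42k
  have hC₂ : 8 * (131072 * ((d : ℝ) + 1) ^ 2) * Real.exp (4 * (800 * ((d : ℝ) + 1) ^ 2 * ((d : ℝ) + 4)) * α₀) ≤ C2T d α₀ := le_rfl
  have hs0 : 0 < α₀ + α₁ := by positivity
  -- Prop. 3's constants versus Theorem 2's: `c⋆ = 5dLB₀(α₀ + α₁ᵉ) < B₁(α₀ + α₁)`, `5dLB₀(β₀)(α₀ + α₁ᵉ) < B₂(α₀ + α₁)`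
  have h1e : α₀ + α₁e ≤ (1 + 11 * (d : ℝ) ^ 2) * (α₀ + α₁) := by
    rw [hα₁e_def, alpha1e]; nlinarith [sq_nonneg (d : ℝ), hα₁.le]
  have hcB : cstar < B₁ * (α₀ + α₁) := by
    have h5 : 0 ≤ 5 * (d : ℝ) * L * B₀ := by positivity
    calc cstar = 5 * d * L * B₀ * (α₀ + α₁e) := hc
      _ ≤ 5 * d * L * B₀ * ((1 + 11 * (d : ℝ) ^ 2) * (α₀ + α₁)) := mul_le_mul_of_nonneg_left h1e h5
      _ = 5 * d * L * B₀ * (1 + 11 * (d : ℝ) ^ 2) * (α₀ + α₁) := by ring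
      _ < B₁ * (α₀ + α₁) := mul_lt_mul_of_pos_right hB₁ hs0
  have hRβ : 5 * d * L * B₀β * (α₀ + α₁e) < B₂ * (α₀ + α₁) := by
    have h5 : 0 ≤ 5 * (d : ℝ) * L * B₀β := by positivity
    calc 5 * d * L * B₀β * (α₀ + α₁e) ≤ 5 * d * L * B₀β * ((1 + 11 * (d : ℝ) ^ 2) * (α₀ + α₁)) :=
          mul_le_mul_of_nonneg_left h1e h5
      _ = 5 * d * L * B₀β * (1 + 11 * (d : ℝ) ^ 2) * (α₀ + α₁) := by ring
      _ < B₂ * (α₀ + α₁) := mul_lt_mul_of_pos_right hB₂ hs0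
  have hB₁0 : 0 ≤ B₁ := by
    have : (0 : ℝ) ≤ 5 * d * L * B₀ * (1 + 11 * (d : ℝ) ^ 2) := by positivity
    linarith
  have hcA0 : 0 ≤ B₁ * (α₀ + α₁) := by positivity
  -- (1.33)–(1.35) ⟹ (1.66)₀ (p. 87)
  have h66 : ∀ (x : Site d) (κ : Fin d), ‖((U' x κ : 𝔸ˣ) : 𝔸) - 1‖ ≤ α₁e := by
    intro x κ
    have h := norm_sub_one_le_torus hd1 hL k hU₀u hU'u hα₀ hw.c0 (by linarith [hw.c2]) hα₁.le hw.a6 h33 h34 hAx h35 x κ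
    simpa [hα₁e_def, alpha1e] using h
  -- Theorem 4's induction up to level `k` (pp. 88–95)
  obtain ⟨u, W, huG, huP, h129, hW, hLanW, hA⟩ := torus_all_levels hd2 hη hL hG hU₀ hU' (P := P) hα₀ hα₁e0 hα₄0 hB₀ hc
    hw.a84 hw.c12 (by linarith [hw.a6] : α₁e ≤ 1 / 4) hw.a2 hw.c0 hw.c2 hw.g16 hw.gd5 hw.gexp hw.gc3 hw.g36 hw.g50 hC₂ hw.g61
    h33 h34 h66 hP5b hP5s h42 h59 k le_rfl
  have hLan := hLanW hk
  have huu : ∀ x, u x ∈ unitaryUnits 𝔸 := fun x => hG (huG x)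
  have hsa : ∀ (x : Site d) (κ : Fin d), IsSelfAdjoint (logCfg η W x κ) := fun x κ => (hA x κ).2.1
  have hWe : ∀ (x : Site d) (κ : Fin d), W x κ = cfgExp η (logCfg η W) x κ := fun x κ => (hA x κ).1
  have hbd : ∀ (x : Site d) (κ : Fin d), ‖logCfg η W x κ‖ ≤ cstar * ((L : ℝ) ^ k * η)⁻¹ := fun x κ => (hA x κ).2.2
  have hcg : cstar ≤ 2 * (L * cstar) + 8 * α₄ := by nlinarith
  have hbdg : ∀ (x : Site d) (κ : Fin d), ‖logCfg η W x κ‖ ≤ (2 * (L * cstar) + 8 * α₄) * ((L : ℝ) ^ k * η)⁻¹ :=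
    fun x κ => (hbd x κ).trans (mul_le_mul_of_nonneg_right hcg (inv_pos.mpr (B8ScaledSupNorm.scale_pos hL1 hη k)).le)
  -- Proposition 3 for the final field, all members (p. 88)
  obtain ⟨hgrad, hdd, hlap, hhol⟩ := final_norms hd2 hη hL hk hG hU₀ (P := P) hα₀ hα₁e0 hα₄0 hB₀ hB₀β hc hw.c0 hw.c2
    hw.g16 hw.gd5 hw.gexp hw.gc3 hw.g36 hw.g50 hC₂ hw.g61 h33 h34 h42 h59 huG huP hW h129 hLan hA
  -- the field `W = U′^{u⁻¹}` and its exponent are periodic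
  have hWeq : W = mgauge U₀ u⁻¹ U' := B8Prop3GaugeFixedKLevel.eq_mgauge_inv_of_mgauge_eq hW
  have hWp : ∀ (x : Site d) (i : Fin d) (κ : Fin d), W (x + P • e i) κ = W x κ := by
    intro x i κ
    rw [hWeq]
    exact mgauge_periodic (fun y τ => hU₀p y i τ) (fun y τ => hU'p y i τ)
      (fun y => by rw [Pi.inv_apply, Pi.inv_apply, huP]) x κ
  -- THE CONCLUSION (1.36)–(1.39) for `A = (1/iη) log W`
  have hconcl : Concl2T L k P η β₀ B₁ B₂ len α₀ α₁ U₀ U' u := by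
    refine ⟨logCfg η W, hsa, fun x i μ => by simp only [logCfg, hWp], ?_, ⟨?_, ?_, ?_⟩, ?_, hLan, ⟨?_, ?_⟩⟩
    · -- `U′^{u⁻¹} = e^{iηA}`
      rw [← hWeq]; funext x μ; exact hWe x μ
    · -- (1.36)₁
      intro j hj x μ
      exact ((hbd x μ).trans (bound_anti_level₁ hL1 hη hcstar0 hj)).trans_lt
        (mul_lt_mul_of_pos_right hcB (inv_pos.mpr (B8ScaledSupNorm.scale_pos hL1 hη j)))
    · -- (1.36)₂
      intro j hj x μ κ
      have h1 := le_mul_inv_pow_of_pow_mul_le (B8ScaledSupNorm.scale_pos hL1 hη k) 2 (hgrad x μ κ)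
      rw [← hc] at h1
      exact (h1.trans (bound_anti_level hL1 hη hcstar0 hj 2)).trans_lt
        (mul_lt_mul_of_pos_right hcB (pow_pos (inv_pos.mpr (B8ScaledSupNorm.scale_pos hL1 hη j)) 2))
    · -- (1.36)₃, the Hölder member
      intro β hβ hββ₀ j hj μ κ q hq
      have hwk : 0 < (L : ℝ) ^ k * η := B8ScaledSupNorm.scale_pos hL1 hη k
      have hwj : 0 < (L : ℝ) ^ j * η := B8ScaledSupNorm.scale_pos hL1 hη j
      have h1 := le_mul_inv_rpow_of_rpow_mul_le hwk (2 + β) (hhol β hβ hββ₀ μ κ q hq)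
      have hR0 : 0 ≤ 5 * d * L * B₀β * (α₀ + α₁e) := by positivity
      have h2 : (((L : ℝ) ^ k * η)⁻¹) ^ (2 + β) ≤ (((L : ℝ) ^ j * η)⁻¹) ^ (2 + β) := by
        apply Real.rpow_le_rpow (inv_pos.mpr hwk).le _ (by linarith)
        exact (inv_le_inv₀ hwk hwj).2 (mul_le_mul_of_nonneg_right (pow_le_pow_right₀ hLr hj) hη.le)
      exact (h1.trans (mul_le_mul_of_nonneg_left h2 hR0)).trans_lt
        (mul_lt_mul_of_pos_right hRβ (Real.rpow_pos_of_pos (inv_pos.mpr hwj) _))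
    · -- (1.37), with the `α₁` of (1.35)
      exact h42k u W (logCfg η W) huG huP hW h129 hLan hsa hWe hbdg
    · -- (1.39)₁
      intro j hj x μ
      have h1 := le_mul_inv_pow_of_pow_mul_le (B8ScaledSupNorm.scale_pos hL1 hη k) 3 (hdd x μ)
      rw [← hc] at h1
      exact (h1.trans (bound_anti_level hL1 hη hcstar0 hj 3)).trans_lt
        (mul_lt_mul_of_pos_right hcB (pow_pos (inv_pos.mpr (B8ScaledSupNorm.scale_pos hL1 hη j)) 3))
    · -- (1.39)₂
      intro j hj x κ
      have h1 := le_mul_inv_pow_of_pow_mul_le (B8ScaledSupNorm.scale_pos hL1 hη k) 3 (hlap x κ)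
      rw [← hc] at h1
      exact (h1.trans (bound_anti_level hL1 hη hcstar0 hj 3)).trans_lt
        (mul_lt_mul_of_pos_right hcB (pow_pos (inv_pos.mpr (B8ScaledSupNorm.scale_pos hL1 hη j)) 3))
  refine ⟨u, ⟨huG, huP, h129, hconcl⟩, fun u' hu'G hu'P h129' hC' => ?_⟩
  -- UNIQUENESS (p. 95)
  obtain ⟨A', hsa', -, hexp', h36', -, h38', -⟩ := hC'
  have h₁ : mgauge U₀ u (cfgExp η (logCfg η W)) = U' := by
    have : cfgExp η (logCfg η W) = W := by funext x μ; exact (hWe x μ).symm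
    rw [this, hW]
  have h₂ : mgauge U₀ u' (cfgExp η A') = U' := by
    rw [← hexp', B7Eq106Concrete.mgauge_mgauge, mul_inv_cancel, mgauge_one_left']
  have h62₁ : ∀ (x : Site d) (κ : Fin d), ‖logCfg η W x κ‖ ≤ B₁ * (α₀ + α₁) * ((L : ℝ) ^ k * η)⁻¹ :=
    fun x κ => (hbd x κ).trans (mul_le_mul_of_nonneg_right hcB.le (inv_pos.mpr (B8ScaledSupNorm.scale_pos hL1 hη k)).le)
  have h62₂ : ∀ (x : Site d) (κ : Fin d), ‖A' x κ‖ ≤ B₁ * (α₀ + α₁) * ((L : ℝ) ^ k * η)⁻¹ :=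
    fun x κ => (h36'.1 k le_rfl x κ).le
  exact (torus_unique hd1 hη hL hG hU₀ hU' (P := P) hα₀ hw.c0 hw.c2 hcA0 hw.uexp hw.uc3 hw.u2048 hw.u40 hw.ucu₁ hw.ucu₂ h33 h34
    hAx hUq huG huP hu'G hu'P h129 h129' h₁ h₂ hsa h62₁ h62₂ hLan h38').symm

/-- **THEOREM 2 ([Balaban1985RegularSpaces] p. 83) FOR THE DOMAIN SEQUENCE `Ω_j = T_η` — THE INTERFACE `B8Thm2TorusAt.Thm2TorusAt L k P η β₀ B₁
B₂ c₁ len G (fun _ => True)` SUPPLIED, MODULO THE SOCKETS.**  «There exist constants B₁, B₂(β₀), c₁ such that for arbitrary U₀, U′U₀ satisfying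
(1.33)–(1.35) with α₀ + α₁ ≦ c₁ there exists exactly one gauge transformation u satisfying (1.29) and such that the conditions (1.36)–(1.39)
hold for the configuration U₁ = U′^{u⁻¹}.»  For a gauge group `G ≤ U(𝔸)` (`SU(N)`: `thm2TorusAt_specialUnitary_of_sockets`), `d ≥ 2`, `L ≥ 2`,
`k ≥ 1`, `η > 0`, any period `P`, Hölder data `β₀, len`, constants `B₁ > 5dLB₀(1 + 11d²)`, `B₂ > 5dLB₀(β₀)(1 + 11d²)` and a threshold `c₁`
such that for every `α₀, α₁ > 0` with `α₀ + α₁ ≤ c₁` the windows `Thm2TorusWindows` hold and, for every admissible pair `U₀, U′`, the sockets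
`Thm2TorusSockets` (Proposition 5 — Sects. C–E —, the in-edge (1.59) = [4] Thm 3.3, the (1.42) clause): `Thm2TorusAt … G (fun _ => True)`, the
regularity rider «(3.35) of [4]» being dropped as print does (p. 82 «eventually we will drop it out of the assumptions», Prop. 6).  The torus
twin of the `ℤᵈ` existence half `B8Thm2GaugeFixedKLevel.thm2_exists_gaugeFixed_kLevel`, with uniqueness; consumed by
`B8Thm2SetupTorus.thm2SetupSUAt_of_thm2TorusAt` (the T³ lane's `Thm2SetupSUAt … (fun _ => True)`).  HONEST SCOPE: a theorem MODULO SOCKETS —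
nothing of Sects. C–E or of [4] is proved here; explicit sufficient windows; `T_η ↦` `P`-periodic `ℤᵈ` data; count-neutral; nothing continuum ∕
ℝ⁴ ∕ OS ∕ mass-gap ∕ Clay. [cite: Balaban1985RegularSpaces, Thm 2 p.83, (1.33)–(1.39) pp.82–83, p.82 («eventually we will drop it»), Thm 4 p.88, p.95] -/
theorem thm2TorusAt_of_sockets (hd2 : 2 ≤ d) (hη : 0 < η) (hL : 2 ≤ L) (hk : 1 ≤ k) (P : ℤ) (hG : G ≤ unitaryUnits 𝔸)
    {β₀ B₀ B₀β B₄ cu B₁ B₂ c₁ : ℝ} {len : Site d → ℝ} (hB₀ : 0 ≤ B₀) (hB₀β : 0 ≤ B₀β) (hB₄ : 0 ≤ B₄)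
    (hB₁ : 5 * d * L * B₀ * (1 + 11 * (d : ℝ) ^ 2) < B₁) (hB₂ : 5 * d * L * B₀β * (1 + 11 * (d : ℝ) ^ 2) < B₂)
    (hW : ∀ ⦃α₀ α₁ : ℝ⦄, 0 < α₀ → 0 < α₁ → α₀ + α₁ ≤ c₁ → Thm2TorusWindows d L B₀ B₄ cu B₁ α₀ α₁)
    (hS : ∀ ⦃α₀ α₁ : ℝ⦄, 0 < α₀ → 0 < α₁ → α₀ + α₁ ≤ c₁ → ∀ U₀ U' : Site d → Fin d → 𝔸ˣ,
      (∀ x κ, U₀ x κ ∈ G) → (∀ x κ, U' x κ ∈ G) →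
      (∀ i : Fin d, shiftCfg (P • e i) U₀ = U₀) → (∀ i : Fin d, shiftCfg (P • e i) U' = U') →
      InAk L k η α₀ (fun _ => (Set.univ : Set (Site d))) U₀ → InAk L k η α₀ (fun _ => (Set.univ : Set (Site d))) (U' * U₀) →
      InAx L k (torusLam k) U₀ (U' * U₀) → Hyp135 L k (torusLam k) α₁ U₀ U' →
      Thm2TorusSockets L k P η β₀ B₀ B₀β B₄ cu B₁ len G α₀ α₁ U₀ U') :
    Thm2TorusAt L k P η β₀ B₁ B₂ c₁ len G (fun _ => True) := by
  intro α₀ α₁ hα₀ hα₁ hc U₀ U' hU₀ hU' hU₀P hU'P h33 _ h34 hAx h35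
  exact thm2_torus_pair hd2 hη hL hk hG hB₀ hB₀β hB₄ hB₁ hB₂ hα₀ hα₁ (hW hα₀ hα₁ hc) hU₀ hU' hU₀P hU'P h33 h34 hAx h35
    (hS hα₀ hα₁ hc U₀ U' hU₀ hU' hU₀P hU'P h33 h34 hAx h35)

end Assembly

section SpecialUnitary

open scoped Matrix.Norms.L2Operator

variable {N : ℕ} [NeZero N]

/-- **THEOREM 2 ON THE TORUS FOR `G = SU(N)`** (`B7Prop2SpecialUnitary.specialUnitaryUnits (Fin N) ≤ unitaryUnits M_N(ℂ)`, operator norm of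
[3] (19)): the instance of `thm2TorusAt_of_sockets` consumed by the T³ lane through `B8Thm2SetupTorus.thm2SetupSUAt_of_thm2TorusAt`
(`Thm2SetupSUAt … (fun _ => True)`, the P-V3-A row of `Summits/…/UnitScaleTiltProp7SPrintThm2Dict`).  Same sockets, same windows, same honest
scope: modulo Proposition 5, (1.59), (1.42); nothing continuum ∕ mass-gap ∕ Clay. [cite: Balaban1985RegularSpaces, Thm 2 p.83; Balaban1985Averaging, p.20 («Lie subgroup G of U(N)»)] -/
theorem thm2TorusAt_specialUnitary_of_sockets (hd2 : 2 ≤ d) {L k : ℕ} {P : ℤ} {η : ℝ} (hη : 0 < η) (hL : 2 ≤ L) (hk : 1 ≤ k)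
    {β₀ B₀ B₀β B₄ cu B₁ B₂ c₁ : ℝ} {len : Site d → ℝ} (hB₀ : 0 ≤ B₀) (hB₀β : 0 ≤ B₀β) (hB₄ : 0 ≤ B₄)
    (hB₁ : 5 * d * L * B₀ * (1 + 11 * (d : ℝ) ^ 2) < B₁) (hB₂ : 5 * d * L * B₀β * (1 + 11 * (d : ℝ) ^ 2) < B₂)
    (hW : ∀ ⦃α₀ α₁ : ℝ⦄, 0 < α₀ → 0 < α₁ → α₀ + α₁ ≤ c₁ → Thm2TorusWindows d L B₀ B₄ cu B₁ α₀ α₁)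
    (hS : ∀ ⦃α₀ α₁ : ℝ⦄, 0 < α₀ → 0 < α₁ → α₀ + α₁ ≤ c₁ → ∀ U₀ U' : Site d → Fin d → (Matrix (Fin N) (Fin N) ℂ)ˣ,
      (∀ x κ, U₀ x κ ∈ B7Prop2SpecialUnitary.specialUnitaryUnits (Fin N)) →
      (∀ x κ, U' x κ ∈ B7Prop2SpecialUnitary.specialUnitaryUnits (Fin N)) →
      (∀ i : Fin d, shiftCfg (P • e i) U₀ = U₀) → (∀ i : Fin d, shiftCfg (P • e i) U' = U') →
      InAk L k η α₀ (fun _ => (Set.univ : Set (Site d))) U₀ → InAk L k η α₀ (fun _ => (Set.univ : Set (Site d))) (U' * U₀) →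
      InAx L k (torusLam k) U₀ (U' * U₀) → Hyp135 L k (torusLam k) α₁ U₀ U' →
      Thm2TorusSockets L k P η β₀ B₀ B₀β B₄ cu B₁ len (B7Prop2SpecialUnitary.specialUnitaryUnits (Fin N)) α₀ α₁ U₀ U') :
    Thm2TorusAt L k P η β₀ B₁ B₂ c₁ len (B7Prop2SpecialUnitary.specialUnitaryUnits (Fin N)) (fun _ => True) := by
  letI : CStarAlgebra (Matrix (Fin N) (Fin N) ℂ) := {}
  haveI : Nonempty (Fin N) := ⟨⟨0, Nat.pos_of_ne_zero (NeZero.ne N)⟩⟩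
  exact thm2TorusAt_of_sockets hd2 hη hL hk P B7Prop2SpecialUnitary.specialUnitaryUnits_le_unitaryUnits hB₀ hB₀β hB₄ hB₁ hB₂ hW hS

end SpecialUnitary

/-! ## §9 Non-vacuity of the windows: print's «there exist constants … c₁» — one threshold `c₁ > 0` (depending on `d`, `L` and the socket
constants only, NOT on `k`, `η`, `P`) below which all the windows hold -/

section Threshold

/-- `S ≤ b/(c(x + 1))` gives `c·x·S ≤ b` (`x, b ≥ 0`, `c > 0`). [folklore] -/
private theorem mul_mul_le_of_le_div {x S b c : ℝ} (hx : 0 ≤ x) (hb : 0 ≤ b) (hc : 0 < c) (hS : S ≤ b / (c * (x + 1))) :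
    c * x * S ≤ b := by
  have h1 : c * x * S ≤ c * x * (b / (c * (x + 1))) := mul_le_mul_of_nonneg_left hS (by positivity)
  have h2 : c * x * (b / (c * (x + 1))) = b * (x / (x + 1)) := by
    field_simp
  have h3 : x / (x + 1) ≤ 1 := by rw [div_le_one (by linarith)]; linarith
  calc c * x * S ≤ b * (x / (x + 1)) := by rw [← h2]; exact h1
    _ ≤ b * 1 := mul_le_mul_of_nonneg_left h3 hb
    _ = b := mul_one _

/-- `e^{x} ≤ 8/7` for `0 ≤ x ≤ 1/8` (`Real.exp_bound_div_one_sub_of_interval`). [folklore] -/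
private theorem exp_le_of_le_eighth {x : ℝ} (h0 : 0 ≤ x) (h8 : x ≤ 1 / 8) : Real.exp x ≤ 8 / 7 := by
  have h := Real.exp_bound_div_one_sub_of_interval h0 (by linarith)
  refine h.trans ?_
  rw [div_le_div_iff₀ (by linarith) (by norm_num)]
  linarith

/-- **THE THRESHOLD `c₁` OF THEOREM 2 ON THE TORUS** («There exist constants B₁, B₂(β₀), c₁ …», p. 83; «for α₀ + α₁ sufficiently small», p. 95):
for `d, L ≥ 1`, `5dLB₀ ≥ 2` («at least for B₁ not too small», p. 89), `B₄ ≥ 0`, `B₁ ≥ 0` and a positive radius `c_u` of (1.109) there is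
`c₁ > 0` — depending on `d`, `L`, `B₀`, `B₄`, `B₁`, `c_u` only, NOT on the number of levels `k`, the spacing `η` or the period `P` — such that
the windows `Thm2TorusWindows d L B₀ B₄ c_u B₁ α₀ α₁` hold for all `α₀, α₁ > 0` with `α₀ + α₁ ≤ c₁`.  (Bookkeeping: every window is linear
in `α₀ + α₁` after `α₁ᵉ ≤ (1 + 11d²)(α₀ + α₁)` and `e^{K₁α₀} ≤ 8/7`.) [cite: Balaban1985RegularSpaces, Thm 2 p.83, p.89 («at least for B₁ not too small»), p.95 («for α₀ + α₁ sufficiently small»)] -/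
theorem thm2TorusWindows_threshold {d L : ℕ} (hd : 1 ≤ d) (hL : 1 ≤ L) {B₀ B₄ cu B₁ : ℝ} (hB₀ : 2 ≤ 5 * d * L * B₀)
    (hB₄ : 0 ≤ B₄) (hcu : 0 < cu) (hB₁ : 0 ≤ B₁) :
    ∃ c₁ : ℝ, 0 < c₁ ∧ ∀ ⦃α₀ α₁ : ℝ⦄, 0 < α₀ → 0 < α₁ → α₀ + α₁ ≤ c₁ → Thm2TorusWindows d L B₀ B₄ cu B₁ α₀ α₁ := by
  have hd' : (1 : ℝ) ≤ d := by exact_mod_cast hd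
  have hL' : (1 : ℝ) ≤ L := by exact_mod_cast hL
  have h5dL : 0 < 5 * (d : ℝ) * L := by positivity
  have hB₀' : 0 ≤ B₀ := by
    by_contra h
    have hB : B₀ < 0 := lt_of_not_ge h
    have : 5 * (d : ℝ) * L * B₀ < 0 := mul_neg_of_pos_of_neg h5dL hB
    linarith only [this, hB₀]
  have hC0 : 0 < C0 d := C0_pos d
  have hc2 : 0 < c2' d L := c2'_pos d L hL
  have hc3 : 0 < c3 d L := B7Prop3Flat.c3_pos d hL
  -- the slopes
  set K : ℝ := 1 + 11 * (d : ℝ) ^ 2 with hK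
  set M₃ : ℝ := 10 * d * (L : ℝ) ^ 2 * B₀ + 8 * B₄ with hM₃
  set K₁ : ℝ := 4 * (800 * ((d : ℝ) + 1) ^ 2 * ((d : ℝ) + 4)) with hK₁
  set K₂ : ℝ := 8 * (131072 * ((d : ℝ) + 1) ^ 2) with hK₂
  have hK0 : 1 ≤ K := by rw [hK]; nlinarith only [sq_nonneg (d : ℝ)]
  have hM₃0 : 0 ≤ M₃ := by rw [hM₃]; positivity
  have hK₁0 : 0 ≤ K₁ := by rw [hK₁]; positivity
  have hK₂0 : 0 ≤ K₂ := by rw [hK₂]; positivity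
  -- the numerator and the denominators of the threshold
  set b : ℝ := min (min (min 1 (c2' d L)) (c3 d L)) cu with hb
  have hb0 : 0 < b := lt_min (lt_min (lt_min one_pos hc2) hc3) hcu
  have hb1 : b ≤ 1 := ((min_le_left _ _).trans (min_le_left _ _)).trans (min_le_left _ _)
  have hbc2 : b ≤ c2' d L := ((min_le_left _ _).trans (min_le_left _ _)).trans (min_le_right _ _)
  have hbc3 : b ≤ c3 d L := (min_le_left _ _).trans (min_le_right _ _)
  have hbcu : b ≤ cu := min_le_right _ _
  have hD1 : (0 : ℝ) < 3 * C0 d := by positivity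
  have hD2 : (0 : ℝ) < 4 := by norm_num
  have hD3 : (0 : ℝ) < 6 * K := by positivity
  have hD4 : (0 : ℝ) < 84 * (B₄ * K + 1) := by positivity
  have hD5 : (0 : ℝ) < 12 * (5 * d * (L : ℝ) ^ 2 * B₀ * K + 1) := by positivity
  have hD6 : (0 : ℝ) < 16 * (M₃ * K + 1) := by positivity
  have hD7 : (0 : ℝ) < 5 * (M₃ * K * d + 1) := by positivity
  have hD8 : (0 : ℝ) < 8 * (K₁ + 1) := by positivity
  have hD9 : (0 : ℝ) < 4 * (K₂ * M₃ * K + 1) := by positivity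
  have hD10 : (0 : ℝ) < 2 * (M₃ * K + 1) := by positivity
  have hD11 : (0 : ℝ) < 72 * (d * B₀ * M₃ * K + 1) := by positivity
  have hD12 : (0 : ℝ) < 50 * (d * M₃ * K + 1) := by positivity
  have hD13 : (0 : ℝ) < 1 * ((2 * M₃ ^ 2 * K + 20 * d * M₃ + 4 * K₂ * M₃ ^ 2 * K) + 1) := by positivity
  have hD14 : (0 : ℝ) < 4 * (K₂ * B₁ + 1) := by positivity
  have hD15 : (0 : ℝ) < 2 * (B₁ + 1) := by positivity
  have hD16 : (0 : ℝ) < 2048 * (d * B₁ + 1) := by positivity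
  have hD17 : (0 : ℝ) < 5000 * (40 * d * B₁ + 1) := by positivity
  have hD18 : (0 : ℝ) < 2 * (200 * d * B₁ + 1) := by positivity
  have hD19 : (0 : ℝ) < 2 * (5 * B₁ + 1) := by positivity
  -- the threshold: the least of the nineteen window thresholds
  refine ⟨min (1 / (3 * C0 d))
      (min (c2' d L / 4)
      (min (1 / (6 * K))
      (min (1 / (84 * (B₄ * K + 1)))
      (min (1 / (12 * (5 * d * (L : ℝ) ^ 2 * B₀ * K + 1)))
      (min (1 / (16 * (M₃ * K + 1)))
      (min (1 / (5 * (M₃ * K * d + 1)))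
      (min (1 / (8 * (K₁ + 1)))
      (min (1 / (4 * (K₂ * M₃ * K + 1)))
      (min (c3 d L / (2 * (M₃ * K + 1)))
      (min (1 / (72 * (d * B₀ * M₃ * K + 1)))
      (min (1 / (50 * (d * M₃ * K + 1)))
      (min (1 / (1 * ((2 * M₃ ^ 2 * K + 20 * d * M₃ + 4 * K₂ * M₃ ^ 2 * K) + 1)))
      (min (1 / (4 * (K₂ * B₁ + 1)))
      (min (c3 d L / (2 * (B₁ + 1)))
      (min (1 / (2048 * (d * B₁ + 1)))
      (min (1 / (5000 * (40 * d * B₁ + 1)))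
      (min (cu / (2 * (200 * d * B₁ + 1)))
      (cu / (2 * (5 * B₁ + 1)))))))))))))))))))),
    lt_min (div_pos one_pos hD1)
      (lt_min (div_pos hc2 hD2)
      (lt_min (div_pos one_pos hD3)
      (lt_min (div_pos one_pos hD4)
      (lt_min (div_pos one_pos hD5)
      (lt_min (div_pos one_pos hD6)
      (lt_min (div_pos one_pos hD7)
      (lt_min (div_pos one_pos hD8)
      (lt_min (div_pos one_pos hD9)
      (lt_min (div_pos hc3 hD10)
      (lt_min (div_pos one_pos hD11)
      (lt_min (div_pos one_pos hD12)
      (lt_min (div_pos one_pos hD13)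
      (lt_min (div_pos one_pos hD14)
      (lt_min (div_pos hc3 hD15)
      (lt_min (div_pos one_pos hD16)
      (lt_min (div_pos one_pos hD17)
      (lt_min (div_pos hcu hD18)
      (div_pos hcu hD19)))))))))))))))))), fun α₀ α₁ hα₀ hα₁ hS => ?_⟩
  set S : ℝ := α₀ + α₁ with hS_def
  have hS0 : 0 ≤ S := by rw [hS_def]; linarith only [hα₀, hα₁]
  -- `S ≤ tᵢ` for every window (walking down the chain of minima)
  have r := hS
  have l1 : S ≤ 1 / (3 * C0 d) := r.trans (min_le_left _ _)
  replace r := r.trans (min_le_right _ _)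
  have l2 : S ≤ c2' d L / 4 := r.trans (min_le_left _ _)
  replace r := r.trans (min_le_right _ _)
  have l3 : S ≤ 1 / (6 * K) := r.trans (min_le_left _ _)
  replace r := r.trans (min_le_right _ _)
  have l4 : S ≤ 1 / (84 * (B₄ * K + 1)) := r.trans (min_le_left _ _)
  replace r := r.trans (min_le_right _ _)
  have l5 : S ≤ 1 / (12 * (5 * d * (L : ℝ) ^ 2 * B₀ * K + 1)) := r.trans (min_le_left _ _)
  replace r := r.trans (min_le_right _ _)
  have l6 : S ≤ 1 / (16 * (M₃ * K + 1)) := r.trans (min_le_left _ _)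
  replace r := r.trans (min_le_right _ _)
  have l7 : S ≤ 1 / (5 * (M₃ * K * d + 1)) := r.trans (min_le_left _ _)
  replace r := r.trans (min_le_right _ _)
  have l8 : S ≤ 1 / (8 * (K₁ + 1)) := r.trans (min_le_left _ _)
  replace r := r.trans (min_le_right _ _)
  have l9 : S ≤ 1 / (4 * (K₂ * M₃ * K + 1)) := r.trans (min_le_left _ _)
  replace r := r.trans (min_le_right _ _)
  have l10 : S ≤ c3 d L / (2 * (M₃ * K + 1)) := r.trans (min_le_left _ _)
  replace r := r.trans (min_le_right _ _)
  have l11 : S ≤ 1 / (72 * (d * B₀ * M₃ * K + 1)) := r.trans (min_le_left _ _)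
  replace r := r.trans (min_le_right _ _)
  have l12 : S ≤ 1 / (50 * (d * M₃ * K + 1)) := r.trans (min_le_left _ _)
  replace r := r.trans (min_le_right _ _)
  have l13 : S ≤ 1 / (1 * ((2 * M₃ ^ 2 * K + 20 * d * M₃ + 4 * K₂ * M₃ ^ 2 * K) + 1)) := r.trans (min_le_left _ _)
  replace r := r.trans (min_le_right _ _)
  have l14 : S ≤ 1 / (4 * (K₂ * B₁ + 1)) := r.trans (min_le_left _ _)
  replace r := r.trans (min_le_right _ _)
  have l15 : S ≤ c3 d L / (2 * (B₁ + 1)) := r.trans (min_le_left _ _)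
  replace r := r.trans (min_le_right _ _)
  have l16 : S ≤ 1 / (2048 * (d * B₁ + 1)) := r.trans (min_le_left _ _)
  replace r := r.trans (min_le_right _ _)
  have l17 : S ≤ 1 / (5000 * (40 * d * B₁ + 1)) := r.trans (min_le_left _ _)
  replace r := r.trans (min_le_right _ _)
  have l18 : S ≤ cu / (2 * (200 * d * B₁ + 1)) := r.trans (min_le_left _ _)
  replace r := r.trans (min_le_right _ _)
  have l19 : S ≤ cu / (2 * (5 * B₁ + 1)) := r
  clear r hS
  -- the products `c·x·S ≤ bᵢ`
  have m4 := mul_mul_le_of_le_div (by positivity : 0 ≤ B₄ * K) zero_le_one (by norm_num : (0 : ℝ) < 84) l4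
  have m5 := mul_mul_le_of_le_div (by positivity : 0 ≤ 5 * d * (L : ℝ) ^ 2 * B₀ * K) zero_le_one (by norm_num : (0 : ℝ) < 12) l5
  have m6 := mul_mul_le_of_le_div (by positivity : 0 ≤ M₃ * K) zero_le_one (by norm_num : (0 : ℝ) < 16) l6
  have m7 := mul_mul_le_of_le_div (by positivity : 0 ≤ M₃ * K * d) zero_le_one (by norm_num : (0 : ℝ) < 5) l7
  have m8 := mul_mul_le_of_le_div hK₁0 zero_le_one (by norm_num : (0 : ℝ) < 8) l8
  have m9 := mul_mul_le_of_le_div (by positivity : 0 ≤ K₂ * M₃ * K) zero_le_one (by norm_num : (0 : ℝ) < 4) l9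
  have m10 := mul_mul_le_of_le_div (by positivity : 0 ≤ M₃ * K) hc3.le (by norm_num : (0 : ℝ) < 2) l10
  have m11 := mul_mul_le_of_le_div (by positivity : 0 ≤ d * B₀ * M₃ * K) zero_le_one (by norm_num : (0 : ℝ) < 72) l11
  have m12 := mul_mul_le_of_le_div (by positivity : 0 ≤ d * M₃ * K) zero_le_one (by norm_num : (0 : ℝ) < 50) l12
  have m13 := mul_mul_le_of_le_div (by positivity : 0 ≤ 2 * M₃ ^ 2 * K + 20 * d * M₃ + 4 * K₂ * M₃ ^ 2 * K) zero_le_one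
    one_pos l13
  have m14 := mul_mul_le_of_le_div (by positivity : 0 ≤ K₂ * B₁) zero_le_one (by norm_num : (0 : ℝ) < 4) l14
  have m15 := mul_mul_le_of_le_div hB₁ hc3.le (by norm_num : (0 : ℝ) < 2) l15
  have m16 := mul_mul_le_of_le_div (by positivity : 0 ≤ d * B₁) zero_le_one (by norm_num : (0 : ℝ) < 2048) l16
  have m17 := mul_mul_le_of_le_div (by positivity : 0 ≤ 40 * d * B₁) zero_le_one (by norm_num : (0 : ℝ) < 5000) l17
  have m18 := mul_mul_le_of_le_div (by positivity : 0 ≤ 200 * d * B₁) hcu.le (by norm_num : (0 : ℝ) < 2) l18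
  have m19 := mul_mul_le_of_le_div (by positivity : 0 ≤ 5 * B₁) hcu.le (by norm_num : (0 : ℝ) < 2) l19
  clear l4 l5 l6 l7 l8 l9 l10 l11 l12 l13 l14 l15 l16 l17 l18 l19
  -- the renamed `α₁` and the guard as multiples of `S`
  set T : ℝ := α₀ + alpha1e d α₀ α₁ with hT
  have h1e0 : 0 ≤ alpha1e d α₀ α₁ := by rw [alpha1e]; positivity
  have hT0 : 0 < T := by rw [hT]; linarith only [hα₀, h1e0]
  have hα₀S : α₀ ≤ S := by rw [hS_def]; linarith only [hα₁]
  have hTK : T ≤ K * S := by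
    rw [hT, alpha1e, hK, hS_def]
    nlinarith only [sq_nonneg (d : ℝ), hα₀.le, hα₁.le]
  have hTKs : α₀ + alpha1e d α₀ α₁ ≤ K * S := hTK
  have hcs : cstarT d L B₀ α₀ α₁ = 5 * d * L * B₀ * T := rfl
  have hα₄ : alpha4T d B₄ α₀ α₁ = B₄ * T := rfl
  have hg : guardT d L B₀ B₄ α₀ α₁ = M₃ * T := by
    simp only [guardT, hcs, hα₄, hM₃]; ring
  have hMT : M₃ * T ≤ M₃ * K * S := by rw [mul_assoc]; exact mul_le_mul_of_nonneg_left hTK hM₃0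
  have hMT0 : 0 ≤ M₃ * T := by positivity
  -- the exponential factor `e^{K₁α₀} ≤ 8/7`
  have hexp : Real.exp (4 * (800 * ((d : ℝ) + 1) ^ 2 * ((d : ℝ) + 4)) * α₀) ≤ 8 / 7 := by
    apply exp_le_of_le_eighth (by positivity)
    calc 4 * (800 * ((d : ℝ) + 1) ^ 2 * ((d : ℝ) + 4)) * α₀ = K₁ * α₀ := by rw [hK₁]
      _ ≤ K₁ * S := mul_le_mul_of_nonneg_left hα₀S hK₁0
      _ ≤ 1 / 8 := by linarith only [m8]
  have hC₂ : C2T d α₀ ≤ 2 * K₂ := by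
    show K₂ * Real.exp (4 * (800 * ((d : ℝ) + 1) ^ 2 * ((d : ℝ) + 4)) * α₀) ≤ 2 * K₂
    nlinarith only [hexp, hK₂0]
  refine ⟨?_, ?_, ?_, ?_, ?_, ?_, ?_, ?_, ?_, ?_, ?_, ?_, ?_, ?_, ?_, ?_, ?_, ?_, ?_⟩
  · -- c0
    calc C0 d * α₀ ≤ C0 d * S := mul_le_mul_of_nonneg_left hα₀S hC0.le
      _ ≤ C0 d * (1 / (3 * C0 d)) := mul_le_mul_of_nonneg_left l1 hC0.le
      _ = 1 / 3 := by field_simp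
  · -- c2
    have : S ≤ c2' d L / 4 := l2
    linarith only [this, hα₀S]
  · -- a6
    have hKS : K * S ≤ K * (1 / (6 * K)) := mul_le_mul_of_nonneg_left l3 (by linarith only [hK0])
    have hK1 : 0 < K := by linarith only [hK0]
    have e : K * (1 / (6 * K)) = 1 / 6 := by field_simp
    show alpha1e d α₀ α₁ ≤ 1 / 6
    linarith only [hKS, e, hTK, hT, hα₀.le]
  · -- a2 («B₁ not too small»)
    show 2 * alpha1e d α₀ α₁ ≤ cstarT d L B₀ α₀ α₁
    rw [hcs, hT]
    have h5 : 0 ≤ 5 * (d : ℝ) * L * B₀ * α₀ := by positivity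
    nlinarith only [hB₀, h1e0, h5]
  · -- a84
    rw [hα₄]
    nlinarith only [m4, mul_le_mul_of_nonneg_left hTK hB₄]
  · -- c12
    rw [hcs]
    have h5 : 0 ≤ 5 * (d : ℝ) * (L : ℝ) ^ 2 * B₀ := by positivity
    have e : (L : ℝ) * (5 * d * L * B₀ * T) = 5 * d * (L : ℝ) ^ 2 * B₀ * T := by ring
    nlinarith only [m5, mul_le_mul_of_nonneg_left hTK h5, e]
  · -- g16
    rw [hg]; linarith only [m6, hMT]
  · -- gd5
    rw [hg]
    have hd0 : (0 : ℝ) ≤ (d : ℝ) - 1 := by linarith only [hd']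
    have e1 : 5 * (M₃ * T) * ((d : ℝ) - 1) ≤ 5 * (M₃ * K * S) * ((d : ℝ) - 1) :=
      mul_le_mul_of_nonneg_right (by linarith only [hMT]) hd0
    have e2 : 5 * (M₃ * K * S) * ((d : ℝ) - 1) ≤ 5 * (M₃ * K * S) * d :=
      mul_le_mul_of_nonneg_left (by linarith only [hd']) (by positivity)
    linarith only [e1, e2, m7]
  · -- gexp
    have hKg : K₂ * guardT d L B₀ B₄ α₀ α₁ ≤ 1 / 4 := by
      rw [hg]; nlinarith only [m9, mul_le_mul_of_nonneg_left hMT hK₂0]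
    have h1 : 0 ≤ 1 + 8 * (131072 * ((d : ℝ) + 1) ^ 2) * guardT d L B₀ B₄ α₀ α₁ := by
      rw [hg]; positivity
    calc Real.exp (4 * (800 * ((d : ℝ) + 1) ^ 2 * ((d : ℝ) + 4)) * α₀)
          * (1 + 8 * (131072 * ((d : ℝ) + 1) ^ 2) * guardT d L B₀ B₄ α₀ α₁)
        ≤ 8 / 7 * (1 + 1 / 4) := by
          apply mul_le_mul hexp _ h1 (by norm_num)
          show 1 + K₂ * guardT d L B₀ B₄ α₀ α₁ ≤ 1 + 1 / 4
          linarith only [hKg]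
      _ ≤ 2 := by norm_num
  · -- gc3
    rw [hg]; linarith only [m10, hMT]
  · -- g36
    rw [hg]
    have h36 : 0 ≤ 36 * (d : ℝ) * B₀ := by positivity
    nlinarith only [m11, mul_le_mul_of_nonneg_left hMT h36]
  · -- g50
    rw [hg]
    have h50 : 0 ≤ 50 * (d : ℝ) := by positivity
    nlinarith only [m12, mul_le_mul_of_nonneg_left hMT h50]
  · -- g61 = (1.61)
    rw [hg]
    show 2 * (M₃ * T) ^ 2 + 20 * d * α₀ * (M₃ * T) + 2 * C2T d α₀ * (M₃ * T) ^ 2 ≤ T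
    -- `2M₃²T + 20dM₃α₀ + 4K₂M₃²T ≤ 1`, then multiply by `T`
    have hin : 2 * M₃ ^ 2 * T + 20 * d * M₃ * α₀ + 4 * K₂ * M₃ ^ 2 * T ≤ 1 := by
      have e1 : 2 * M₃ ^ 2 * T ≤ 2 * M₃ ^ 2 * (K * S) := mul_le_mul_of_nonneg_left hTK (by positivity)
      have e2 : 20 * d * M₃ * α₀ ≤ 20 * d * M₃ * S := mul_le_mul_of_nonneg_left hα₀S (by positivity)
      have e3 : 4 * K₂ * M₃ ^ 2 * T ≤ 4 * K₂ * M₃ ^ 2 * (K * S) := mul_le_mul_of_nonneg_left hTK (by positivity)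
      linarith only [e1, e2, e3, m13]
    have hsq : 0 ≤ (M₃ * T) ^ 2 := sq_nonneg _
    have hC2T : 2 * C2T d α₀ * (M₃ * T) ^ 2 ≤ 2 * (2 * K₂) * (M₃ * T) ^ 2 :=
      mul_le_mul_of_nonneg_right (by linarith only [hC₂]) hsq
    have hfin := mul_le_mul_of_nonneg_right hin hT0.le
    nlinarith only [hfin, hC2T, hsq, hα₀.le, hT0.le, hM₃0]
  · -- uexp
    have h1 : 0 ≤ 1 + 8 * (131072 * ((d : ℝ) + 1) ^ 2) * (B₁ * (α₀ + α₁)) := by positivity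
    calc Real.exp (4 * (800 * ((d : ℝ) + 1) ^ 2 * ((d : ℝ) + 4)) * α₀) * (1 + 8 * (131072 * ((d : ℝ) + 1) ^ 2) * (B₁ * (α₀ + α₁)))
        ≤ 8 / 7 * (1 + 1 / 4) := by
          apply mul_le_mul hexp _ h1 (by norm_num)
          show 1 + K₂ * (B₁ * S) ≤ 1 + 1 / 4
          linarith only [m14]
      _ ≤ 2 := by norm_num
  · -- uc3
    show 2 * (B₁ * S) ≤ c3 d L
    linarith only [m15]
  · -- u2048
    show 2048 * (d : ℝ) * (B₁ * S) ≤ 1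
    linarith only [m16]
  · -- u40
    show 40 * d * (B₁ * S) ≤ 1 / 5000
    linarith only [m17]
  · -- ucu₁
    show 2 * (2 * (40 * d * (B₁ * S)) + 2 * 1116 * (40 * d * (B₁ * S)) ^ 2) < cu
    have hy0 : 0 ≤ 40 * d * (B₁ * S) := by positivity
    have hy1 : 40 * d * (B₁ * S) ≤ 1 / 5000 := by linarith only [m17]
    have hy2 : (40 * d * (B₁ * S)) ^ 2 ≤ 40 * d * (B₁ * S) * (1 / 5000) := by
      rw [sq]; exact mul_le_mul_of_nonneg_left hy1 hy0
    have hy10 : 10 * (40 * d * (B₁ * S)) ≤ cu := by linarith only [m18]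
    linarith only [hy2, hy10, hcu, hy0]
  · -- ucu₂
    show 5 * (B₁ * S) < cu
    nlinarith only [m19, hcu]

end Threshold

/-! ## §10 Print's quantifier order: «There exist constants B₁, B₂(β₀), c₁ such that …» — the threshold supplied -/

section Exists

variable {𝔸 : Type*} [CStarAlgebra 𝔸] [Nontrivial 𝔸]
variable {L k : ℕ} {η : ℝ} {G : Subgroup 𝔸ˣ}

/-- **THEOREM 2 ON THE TORUS WITH THE THRESHOLD SUPPLIED**: for `B₁ > 5dLB₀(1 + 11d²)`, `B₂ > 5dLB₀(β₀)(1 + 11d²)`, `5dLB₀ ≥ 2`, `c_u > 0`, if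
the sockets `Thm2TorusSockets` hold for every `α₀, α₁ > 0` with `α₀ + α₁ ≤ c₀` and every admissible pair, then THERE IS `c₁ > 0` with
`Thm2TorusAt L k P η β₀ B₁ B₂ c₁ len G (fun _ => True)` (`c₁ = min` of `c₀` and the window threshold of `thm2TorusWindows_threshold`, independent of
`k`, `P`, `η`).  Same honest scope: modulo Proposition 5, (1.59), (1.42). [cite: Balaban1985RegularSpaces, Thm 2 p.83] -/
theorem thm2TorusAt_of_sockets_threshold (hd2 : 2 ≤ d) (hη : 0 < η) (hL : 2 ≤ L) (hk : 1 ≤ k) (P : ℤ) (hG : G ≤ unitaryUnits 𝔸)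
    {β₀ B₀ B₀β B₄ cu B₁ B₂ c₀ : ℝ} {len : Site d → ℝ} (hB₀ : 2 ≤ 5 * d * L * B₀) (hB₀β : 0 ≤ B₀β) (hB₄ : 0 ≤ B₄) (hcu : 0 < cu)
    (hB₁ : 5 * d * L * B₀ * (1 + 11 * (d : ℝ) ^ 2) < B₁) (hB₂ : 5 * d * L * B₀β * (1 + 11 * (d : ℝ) ^ 2) < B₂) (hc₀ : 0 < c₀)
    (hS : ∀ ⦃α₀ α₁ : ℝ⦄, 0 < α₀ → 0 < α₁ → α₀ + α₁ ≤ c₀ → ∀ U₀ U' : Site d → Fin d → 𝔸ˣ,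
      (∀ x κ, U₀ x κ ∈ G) → (∀ x κ, U' x κ ∈ G) →
      (∀ i : Fin d, shiftCfg (P • e i) U₀ = U₀) → (∀ i : Fin d, shiftCfg (P • e i) U' = U') →
      InAk L k η α₀ (fun _ => (Set.univ : Set (Site d))) U₀ → InAk L k η α₀ (fun _ => (Set.univ : Set (Site d))) (U' * U₀) →
      InAx L k (torusLam k) U₀ (U' * U₀) → Hyp135 L k (torusLam k) α₁ U₀ U' →
      Thm2TorusSockets L k P η β₀ B₀ B₀β B₄ cu B₁ len G α₀ α₁ U₀ U') :
    ∃ c₁ : ℝ, 0 < c₁ ∧ Thm2TorusAt L k P η β₀ B₁ B₂ c₁ len G (fun _ => True) := by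
  have hL1 : 1 ≤ L := le_trans (by norm_num) hL
  have hd1 : 1 ≤ d := le_trans (by norm_num) hd2
  have hB₀' : 0 ≤ B₀ := by
    have h5 : 0 < 5 * (d : ℝ) * L := by
      have : (1 : ℝ) ≤ d := by exact_mod_cast hd1
      have : (1 : ℝ) ≤ L := by exact_mod_cast hL1
      positivity
    by_contra h
    have := mul_neg_of_pos_of_neg h5 (lt_of_not_ge h)
    linarith
  have hB₁0 : 0 ≤ B₁ := by
    have : (0 : ℝ) ≤ 5 * d * L * B₀ * (1 + 11 * (d : ℝ) ^ 2) := by positivity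
    linarith
  obtain ⟨c, hc, hW⟩ := thm2TorusWindows_threshold hd1 hL1 hB₀ hB₄ hcu hB₁0
  refine ⟨min c c₀, lt_min hc hc₀, thm2TorusAt_of_sockets hd2 hη hL hk P hG hB₀' hB₀β hB₄ hB₁ hB₂
    (fun α₀ α₁ hα₀ hα₁ h => hW hα₀ hα₁ (h.trans (min_le_left _ _)))
    (fun α₀ α₁ hα₀ hα₁ h => hS hα₀ hα₁ (h.trans (min_le_right _ _)))⟩

/-- **THEOREM 2 ON THE TORUS IN PRINT'S QUANTIFIER ORDER — `B8Thm2TorusAt.Thm2TorusUniform L β₀ len G (fun _ _ _ _ => True)` SUPPLIED**: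
«There exist constants B₁, B₂(β₀), c₁ such that …», ONE triple serving every number of levels `k ≥ 1`, every period `P` and every
spacing `η > 0` (p. 83 «the constants B₁, B₂(β₀) in (1.36), (1.39) are absolute constants depending on d and L only, B₂(β₀) on β₀ also»):
`B₁ = 5dLB₀(1 + 11d²) + 1`, `B₂ = 5dLB₀(β₀)(1 + 11d²) + 1`, `c₁` from `thm2TorusWindows_threshold` — GIVEN the sockets for every `k ≥ 1`, `P`,
`η > 0`, every `α₀, α₁ > 0` with `α₀ + α₁ ≤ c₀` and every admissible pair (uniqueness socket at the constant `B₁(α₀ + α₁)`).  Same honest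
scope: modulo Proposition 5, (1.59), (1.42); nothing continuum ∕ mass-gap ∕ Clay. [cite: Balaban1985RegularSpaces, Thm 2 p.83, p.83 (sentence after (1.39))] -/
theorem thm2TorusUniform_of_sockets (hd2 : 2 ≤ d) (hL : 2 ≤ L) (hG : G ≤ unitaryUnits 𝔸)
    {β₀ B₀ B₀β B₄ cu c₀ : ℝ} {len : Site d → ℝ} (hB₀ : 2 ≤ 5 * d * L * B₀) (hB₀β : 0 ≤ B₀β) (hB₄ : 0 ≤ B₄) (hcu : 0 < cu)
    (hc₀ : 0 < c₀)
    (hS : ∀ (k : ℕ) (P : ℤ) (η : ℝ), 1 ≤ k → 0 < η → ∀ ⦃α₀ α₁ : ℝ⦄, 0 < α₀ → 0 < α₁ → α₀ + α₁ ≤ c₀ →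
      ∀ U₀ U' : Site d → Fin d → 𝔸ˣ, (∀ x κ, U₀ x κ ∈ G) → (∀ x κ, U' x κ ∈ G) →
      (∀ i : Fin d, shiftCfg (P • e i) U₀ = U₀) → (∀ i : Fin d, shiftCfg (P • e i) U' = U') →
      InAk L k η α₀ (fun _ => (Set.univ : Set (Site d))) U₀ → InAk L k η α₀ (fun _ => (Set.univ : Set (Site d))) (U' * U₀) →
      InAx L k (torusLam k) U₀ (U' * U₀) → Hyp135 L k (torusLam k) α₁ U₀ U' →
      Thm2TorusSockets L k P η β₀ B₀ B₀β B₄ cu (5 * d * L * B₀ * (1 + 11 * (d : ℝ) ^ 2) + 1) len G α₀ α₁ U₀ U') :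
    B8Thm2TorusAt.Thm2TorusUniform L β₀ len G (fun _ _ _ _ => True) := by
  have hL1 : 1 ≤ L := le_trans (by norm_num) hL
  have hd1 : 1 ≤ d := le_trans (by norm_num) hd2
  have hB₀' : 0 ≤ B₀ := by
    have h5 : 0 < 5 * (d : ℝ) * L := by
      have : (1 : ℝ) ≤ d := by exact_mod_cast hd1
      have : (1 : ℝ) ≤ L := by exact_mod_cast hL1
      positivity
    by_contra h
    have := mul_neg_of_pos_of_neg h5 (lt_of_not_ge h)
    linarith
  set B₁ : ℝ := 5 * d * L * B₀ * (1 + 11 * (d : ℝ) ^ 2) + 1 with hB₁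
  set B₂ : ℝ := 5 * d * L * B₀β * (1 + 11 * (d : ℝ) ^ 2) + 1 with hB₂
  have hB₁gt : 5 * d * L * B₀ * (1 + 11 * (d : ℝ) ^ 2) < B₁ := by rw [hB₁]; linarith
  have hB₂gt : 5 * d * L * B₀β * (1 + 11 * (d : ℝ) ^ 2) < B₂ := by rw [hB₂]; linarith
  have hB₁pos : 0 < B₁ := by
    have : (0 : ℝ) ≤ 5 * d * L * B₀ * (1 + 11 * (d : ℝ) ^ 2) := by positivity
    linarith
  have hB₂pos : 0 < B₂ := by
    have : (0 : ℝ) ≤ 5 * d * L * B₀β * (1 + 11 * (d : ℝ) ^ 2) := by positivity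
    linarith
  obtain ⟨c, hc, hW⟩ := thm2TorusWindows_threshold hd1 hL1 hB₀ hB₄ hcu hB₁pos.le
  refine ⟨B₁, B₂, min c c₀, hB₁pos, hB₂pos, lt_min hc hc₀, fun k P η hk hη => ?_⟩
  exact thm2TorusAt_of_sockets hd2 hη hL hk P hG hB₀' hB₀β hB₄ hB₁gt hB₂gt
    (fun α₀ α₁ hα₀ hα₁ h => hW hα₀ hα₁ (h.trans (min_le_left _ _)))
    (fun α₀ α₁ hα₀ hα₁ h => hS k P η hk hη hα₀ hα₁ (h.trans (min_le_right _ _)))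

end Exists

#print axioms torus_all_levels
#print axioms final_norms
#print axioms torus_unique
#print axioms thm2_torus_pair
#print axioms thm2TorusAt_of_sockets
#print axioms thm2TorusAt_specialUnitary_of_sockets
#print axioms thm2TorusWindows_threshold
#print axioms thm2TorusAt_of_sockets_threshold
#print axioms thm2TorusUniform_of_sockets

end Literature.MathematicalPhysics.QuantumFieldTheory.Balaban1983to89.B8Thm2TorusSupplier

end
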